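import Literature.Computability.AlgebraicComplexity.BDI20HwvEvaluationHardness
import Literature.Computability.AlgebraicComplexity.PlethysmTableauPerms
import Mathlib.LinearAlgebra.Vandermonde
import HarnessLib

/-!
# Bläser–Dörfler–Ikenmeyer 2020, Thm 30 (CCC 2021 Thm 8.9): the semistandard tableau `T̂` of an
# 8-regular two-row instance, and `f_T̂(p) ≠ 0 ⟺` proper 3-colourability

M. Bläser, J. Dörfler, C. Ikenmeyer, *On the complexity of evaluating highest weight vectors*,
arXiv:2002.11594 (= CCC 2021, LIPIcs 200:29), §8, proof of Thm 30 [8.9] (arXiv pp. 21–22 =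
`paper:arxiv-2002.11594` p0021–p0022; TeX of record `HOME/lit/src/2002.11594/fullversion.tex`
L2290–2512 incl. Fig. `semistdhardnesstructure` L2317–2348, Fig. `semitabconstr1` (`T_{1,1}`,
`T_{1,i}`) L2451–2482 and Fig. `semitabconstr2` (`T_2`, `T_4`) L2484–2508). Cell `val-lit`,
cross-ladder seat x6 g8 (closer side of the §8 programme, lead-np RULING (124); FILE E of
`HOME/np/MEMO-t21g11-BDI20-sec8-gadgets.md`). HONEST FRAMING: the combinatorial core of a printed
NP-hardness proof about EVALUATING highest weight vectors (row N4, constructivity side); nothing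
here bears on `VP ≠ VNP`, which is NOT proved. No conjecture, no named fact, no `instance`, no
notation; `0` sorries.

## What is formalised

Thm 30's proof reduces 3-colourability of an `8`-regular grid-like layered multigraph `G` to the
nonvanishing of `f_T̂` at the Waring-rank-`5` point `p = Σ_{i=1}^5 ℓ_i^d`, `ℓ_i = (1, i, i², …)`,
for an explicit SEMISTANDARD tableau `T̂ = T₁ T₂ T₃ T₄ T₅` of content `n × 16` (then every column
`d/16` times). The ONLY properties of `G` the proof uses are those delivered by Lemma 25 [8.4]:
after numbering the vertices layer by layer, left to right, the inter-layer edges form a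
semistandard two-row tableau `T_↕` (ordered column list), the intra-layer edges a semistandard
two-row tableau `T_↔`, every vertex lies in a column of `T_↕`, and every vertex lies in exactly
`8` columns. This file therefore takes such a **two-row instance** `(N, S = T_↕, S' = T_↔)` as
input (`Thm30.IsTwoRowInstance`, a `Prop` structure — exactly the output shape of the cell's
Lemma-25 file) and proves, for every `k ≥ 1` and `m ≥ 5`:

* `Thm30.tableau k S S'` — the printed `T̂` with labels `a_i ↦ 0..3r-1`, `b_1 b_2 ↦ 3r, 3r+1`,
  `c_j ↦ 3r+2..11r+1`, `d_1 d_2 ↦ 11r+2, 11r+3`, `e_v ↦ 11r+4+v` ("we assign increasing numbers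
  … first to all the `a_i`, then to all the `b_i, c_i, d_i` and `e_i` in order"), built as the
  HALVED tableau `T₁ T₂ T₃ T₄ T₅` (all printed multiplicities `16, 2, 4, 14, 12, 2` are even) with
  every column then repeated `2k` times in place;
* `isTableauOfContent_tableau` (content `(11r+4+N) × 16k`, partition shape, entries `< 11r+4+N`),
  `isSemistandard_tableau`, `length_le_of_mem_tableau` (`5` rows), `nLabels_le`
  (`11r+4+N ≤ |T_↕| + N + 15`, the "`n = O(|V|)`" of the ETH clause);
* the EVALUATION LEMMA `hwvEvalWaring_doubled_ne_zero_iff`: with every column doubled, the value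
  at `point₅` is the natural number `Σ_κ ∏_c det_c(κ)^{2k}` (Vandermonde determinants, via the
  tree's `TableauEval.ldet_eq_det` and Mathlib's `Matrix.det_vandermonde_ne_zero_iff`), nonzero
  iff SOME placement `κ : labels → {ℓ_1..ℓ_5}` is injective on every column;
* the COMBINATORICS of the printed proof: `colourable_of_injective` (the first column forces
  `a_1 a_2 a_3 b_1 b_2` pairwise distinct; induction along `T₁` forces every blocker pair
  `c_{2j-1} c_{2j}` onto the two forms of `b_1 b_2`; every vertex box shares a column of `T₃` with
  a blocker pair, hence carries one of the other three forms; columns are injective, so the graph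
  is properly 3-coloured) and `injective_of_colourable` (the printed placement);
* ★ `tableau_mem_nonvanishingSetSemistd_iff`:
  `tableau k S S' ∈ nonvanishingSetSemistd (16k) m ↔ Colourable3 (S ++ S')`.

The graph side (3SAT / 3COL ↦ an 8-regular grid-like layered graph ↦ `(N, T_↕, T_↔)`, Lemmas
25–29) and the complexity packaging (`IsNPHard`, ETH via `BDI20HwvETHTransfer`) are NOT in this
file; they consume the theorems above by name.

## Deviations from the print (disclosed; none changes the theorem)

* `r = ⌊|T_↕|/24⌋ + 1` instead of `⌈(|T_↕| - 1)/24⌉` (always `≥ 1`, and `24r + 1 ≥ |T_↕|`, the one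
  inequality used: "`T_{3,1}` has at least as many columns as `T_{3,2}`").
* The value is computed at `point₅ = (ℓ_1, …, ℓ_5)` with `ℓ_i = (1, i, …, i⁴)` (the statement
  file's fixed point; coordinates beyond the fifth never enter a column of height `≤ 5`).
* Labels are `0`-based; forms are indexed `0..4` (`b ↦ 3, 4`, `d ↦ 0, 1`, `a_{3i+j} ↦ j`).

## References
* [BlaserDorflerIkenmeyer2020] arXiv:2002.11594 Thm 30 and its proof (= CCC 2021 Thm 8.9,
  LIPIcs 200:29, pp. 29:30–29:33); Lemma 25 (= Lemma 8.4) for the input shape.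
* Tree: `BDI2020.hwvEvalWaring`, `colDet`, `placements`, `point₅`, `IsTableauOfContent`,
  `IsSemistandard`, `nonvanishingSetSemistd` (`BDI20HwvEvaluationHardness.lean`, x6);
  `TableauEval.ldet_eq_det`, `matOfRows` (`PlethysmTableauPerms.lean`); Mathlib
  `Matrix.vandermonde`, `Matrix.det_vandermonde_ne_zero_iff`.
-/

namespace Literature.Computability.AlgebraicComplexity

namespace BDI2020

namespace Thm30

open TableauEval

/-! ### The integer Vandermonde point and naturality of the evaluation -/

/-- The forms of the fixed point of Thm 30 with INTEGER coordinates: `ℓ_i = (1, i, i², i³, i⁴)`,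
`i = 1..5`. [cite: BlaserDorflerIkenmeyer2020, Thm 30 (proof), arXiv p0021.txt:L20-21] -/
def point₅ℤ : List (List ℤ) :=
  (List.range 5).map fun i => (List.range 5).map fun j => ((i + 1 : ℕ) : ℤ) ^ j

/-- `point₅` is the complexification of `point₅ℤ`. [cite: BlaserDorflerIkenmeyer2020, Thm 30 (proof)] -/
theorem point₅_eq_map : point₅ = point₅ℤ.map fun row => row.map (Int.castRingHom ℂ) := by
  unfold point₅ point₅ℤ
  rw [List.map_map]
  refine List.map_congr_left fun i _ => ?_
  simp only [Function.comp_apply, List.map_map]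
  refine List.map_congr_left fun j _ => ?_
  simp

section Naturality

variable {R R' : Type*} [CommRing R] [CommRing R'] (f : R →+* R')

/-- `sgn` is preserved by ring maps. [folklore] -/
private theorem map_sgn (b : Bool) : f (sgn b) = sgn b := by
  cases b <;> simp [sgn]

/-- Reading an entry commutes with mapping (default `0 ↦ 0`). [folklore] -/
private theorem getD_map_zero (l : List R) (j : ℕ) : (l.map f).getD j 0 = f (l.getD j 0) := by
  rw [List.getD_eq_getElem?_getD, List.getD_eq_getElem?_getD, List.getElem?_map]
  cases l[j]? <;> simp

/-- The Leibniz determinant commutes with ring maps (as in `PerDetHwvCertificateProofs`).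
[folklore] -/
private theorem ldet_map (M : List (List R)) :
    ldet (M.map fun row => row.map f) = f (ldet M) := by
  unfold ldet
  rw [List.length_map, map_list_sum, List.map_map]
  congr 1
  refine List.map_congr_left fun q _ => ?_
  simp only [Function.comp_apply, map_mul, map_sgn, map_list_prod, List.map_zipWith,
    List.zipWith_map_left, getD_map_zero]

/-- Reading a row commutes with mapping (default `[] ↦ []`). [folklore] -/
private theorem getD_map_nil (P : List (List R)) (i : ℕ) :
    (P.map fun row => row.map f).getD i [] = (P.getD i []).map f := by
  rw [List.getD_eq_getElem?_getD, List.getD_eq_getElem?_getD, List.getElem?_map]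
  cases P[i]? <;> simp

/-- The column factor commutes with ring maps. [cite: BlaserDorflerIkenmeyer2020, eq. (5.1) (arXiv eq. (sumpropertheta))] -/
theorem colDet_map (P : List (List R)) (κ c : List ℕ) :
    colDet (P.map fun row => row.map f) κ c = f (colDet P κ c) := by
  unfold colDet
  rw [← ldet_map]
  congr 1
  rw [List.map_map]
  refine List.map_congr_left fun u _ => ?_
  simp only [Function.comp_apply, getD_map_nil]

/-- The Waring-point evaluation commutes with ring maps. [cite: BlaserDorflerIkenmeyer2020, eq. (5.1) (arXiv eq. (sumpropertheta))] -/
theorem hwvEvalWaring_map (T : List (List ℕ)) (n : ℕ) (P : List (List R)) :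
    hwvEvalWaring T n (P.map fun row => row.map f) = f (hwvEvalWaring T n P) := by
  unfold hwvEvalWaring
  rw [List.length_map, map_list_sum, List.map_map]
  congr 1
  refine List.map_congr_left fun κ _ => ?_
  simp only [Function.comp_apply, map_list_prod, List.map_map]
  congr 1
  refine List.map_congr_left fun c _ => ?_
  simp only [Function.comp_apply, colDet_map]

end Naturality

/-! ### Doubled columns: the value is a sum of even powers -/

section Doubling

variable {R : Type*} [CommRing R]

/-- Repeating every column `m` times raises every column factor to the `m`-th power.
[cite: BlaserDorflerIkenmeyer2020, Thm 30 (proof: "every column being repeated an even number of times")] -/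
theorem hwvEvalWaring_flatMap_replicate (D : List (List ℕ)) (m n : ℕ) (L : List (List R)) :
    hwvEvalWaring (D.flatMap fun c => List.replicate m c) n L =
      ((placements n L.length).map fun κ => (D.map fun c => colDet L κ c ^ m).prod).sum := by
  unfold hwvEvalWaring
  congr 1
  refine List.map_congr_left fun κ _ => ?_
  rw [List.map_flatMap, List.flatMap_def, List.prod_flatten, List.map_map]
  congr 1
  refine List.map_congr_left fun c _ => ?_
  simp [List.map_replicate, List.prod_replicate]

end Doubling

/-! ### The column factor at the Vandermonde point -/

/-- The rows of `point₅ℤ`. [cite: BlaserDorflerIkenmeyer2020, Thm 30 (proof)] -/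
theorem point₅ℤ_getD {i j : ℕ} (hi : i < 5) (hj : j < 5) :
    (point₅ℤ.getD i []).getD j 0 = ((i + 1 : ℕ) : ℤ) ^ j := by
  unfold point₅ℤ
  simp only [List.getD_eq_getElem?_getD, List.getElem?_map, List.getElem?_range hi,
    List.getElem?_range hj, Option.map_some, Option.getD_some]

/-- `point₅ℤ` lists `5` forms. [cite: BlaserDorflerIkenmeyer2020, Thm 30 (proof)] -/
theorem length_point₅ℤ : point₅ℤ.length = 5 := by simp [point₅ℤ]

/-- **The column factor of a column of height `≤ 5` at the Vandermonde point is the Vandermonde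
determinant of the nodes `κ(u) + 1` placed in its boxes** ("any determinants arising in the
evaluation are determinants of Vandermonde matrices").
[cite: BlaserDorflerIkenmeyer2020, Thm 30 (proof), arXiv p0021.txt:L21-22] -/
theorem colDet_point₅ℤ_eq_det_vandermonde (κ c : List ℕ) (hc : c.length ≤ 5)
    (hκ : ∀ u ∈ c, κ.getD u 0 < 5) :
    colDet point₅ℤ κ c =
      (Matrix.vandermonde fun a : Fin c.length => ((κ.getD (c.get a) 0 + 1 : ℕ) : ℤ)).det := by
  unfold colDet
  rw [ldet_eq_det _ (by rw [List.length_map])]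
  congr 1
  ext a j
  simp only [matOfRows, Matrix.of_apply, Matrix.vandermonde_apply]
  have ha : (a : ℕ) < c.length := a.2
  have h1 : (List.map (fun u => point₅ℤ.getD (κ.getD u 0) []) c).getD (a : ℕ) [] =
      point₅ℤ.getD (κ.getD (c.get a) 0) [] := by
    simp only [List.getD_eq_getElem?_getD, List.getElem?_map, List.get_eq_getElem,
      List.getElem?_eq_getElem ha, Option.map_some, Option.getD_some]
  have hu : κ.getD (c.get a) 0 < 5 := hκ _ (List.get_mem c a)
  rw [h1, point₅ℤ_getD hu (by omega)]

/-- `c.map g` has no duplicates iff `a ↦ g (c a)` is injective on positions. [folklore] -/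
private theorem nodup_map_iff_injective_get {α β : Type*} (g : α → β) (c : List α) :
    (c.map g).Nodup ↔ Function.Injective fun a : Fin c.length => g (c.get a) := by
  rw [List.nodup_iff_injective_get]
  constructor
  · intro h a b hab
    have := @h (a.cast (by simp)) (b.cast (by simp)) (by simpa using hab)
    simpa [Fin.ext_iff] using this
  · intro h a b hab
    have := @h (a.cast (by simp)) (b.cast (by simp)) (by simpa using hab)
    simpa [Fin.ext_iff] using this

/-- **A column factor at the Vandermonde point is nonzero iff the column carries pairwise
distinct forms** ("will be non-zero iff no column contains the same linear form twice").
[cite: BlaserDorflerIkenmeyer2020, Thm 30 (proof), arXiv p0021.txt:L23-24] -/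
theorem colDet_point₅ℤ_ne_zero_iff (κ c : List ℕ) (hc : c.length ≤ 5)
    (hκ : ∀ u ∈ c, κ.getD u 0 < 5) :
    colDet point₅ℤ κ c ≠ 0 ↔ (c.map fun u => κ.getD u 0).Nodup := by
  rw [colDet_point₅ℤ_eq_det_vandermonde κ c hc hκ, Matrix.det_vandermonde_ne_zero_iff,
    nodup_map_iff_injective_get]
  constructor
  · intro h a b hab
    exact h (by simp only at hab ⊢; rw [hab])
  · intro h a b hab
    apply h
    simp only at hab
    have := Int.ofNat_injective hab
    simpa using this


/-! ### Placements -/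

/-- Placements are the lists of length `n` with entries `< r`. [folklore] -/
private theorem mem_placements_iff {n r : ℕ} {κ : List ℕ} :
    κ ∈ placements n r ↔ κ.length = n ∧ ∀ x ∈ κ, x < r := by
  unfold placements
  rw [List.mem_sections]
  induction n generalizing κ with
  | zero =>
    rw [List.replicate_zero, List.forall₂_nil_right_iff]
    constructor
    · rintro rfl; simp
    · rintro ⟨h, -⟩; exact List.eq_nil_of_length_eq_zero h
  | succ n ih =>
    cases κ with
    | nil => simp
    | cons x κ =>
      rw [List.replicate_succ, List.forall₂_cons, ih]
      simp only [List.mem_range, List.length_cons, Nat.add_right_cancel_iff, List.mem_cons,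
        forall_eq_or_imp]
      tauto

/-- Entries of a placement of `r > 0` forms are `< r` (read with default `0`). [folklore] -/
private theorem getD_lt_of_mem_placements {n r : ℕ} {κ : List ℕ} (h : κ ∈ placements n r)
    (hr : 0 < r) (a : ℕ) : κ.getD a 0 < r := by
  rw [mem_placements_iff] at h
  rw [List.getD_eq_getElem?_getD]
  cases h' : κ[a]? with
  | none => simpa using hr
  | some x => simpa using h.2 x (List.mem_of_getElem? h')

/-- A list of values is a placement when read back through `getD`. [folklore] -/
private theorem map_range_mem_placements {n r : ℕ} (φ : ℕ → ℕ) (hφ : ∀ u < n, φ u < r) :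
    (List.range n).map φ ∈ placements n r := by
  rw [mem_placements_iff]
  refine ⟨by simp, fun x hx => ?_⟩
  rw [List.mem_map] at hx
  obtain ⟨u, hu, rfl⟩ := hx
  exact hφ u (List.mem_range.1 hu)

/-- Reading back a tabulated placement. [folklore] -/
private theorem getD_map_range {n : ℕ} (φ : ℕ → ℕ) {u : ℕ} (hu : u < n) :
    ((List.range n).map φ).getD u 0 = φ u := by
  simp only [List.getD_eq_getElem?_getD, List.getElem?_map, List.getElem?_range hu,
    Option.map_some, Option.getD_some]

/-! ### The value of a tableau with doubled columns at the Vandermonde point -/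

/-- **The summand of a placement** for a column list `D` whose columns are each repeated `m`
times: `∏_{c ∈ D} |det_c(κ)|^m ∈ ℕ`. [cite: BlaserDorflerIkenmeyer2020, Thm 30 (proof: "every summand will be either 0 or positive")] -/
def weight (D : List (List ℕ)) (m : ℕ) (κ : List ℕ) : ℕ :=
  (D.map fun c => (colDet point₅ℤ κ c).natAbs ^ m).prod

/-- `|x|^{2k} = x^{2k}` through the cast `ℕ → ℤ`. [folklore] -/
private theorem cast_natAbs_pow_two_mul (x : ℤ) (k : ℕ) :
    (((x.natAbs ^ (2 * k) : ℕ)) : ℤ) = x ^ (2 * k) := by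
  rw [Nat.cast_pow, pow_mul, pow_mul, Int.natAbs_sq]

/-- **`f_T̂(p)` for `T̂ = D` with every column repeated `2k` times is the sum over all placements
`κ : labels → {ℓ_1, …, ℓ_5}` of the natural numbers `∏_c det_c(κ)^{2k}`** ("Since all vectors are
real, any occuring determinants in the evaluation will also be real and hence every summand will
be either `0` or positive due to every column being repeated an even number of times").
[cite: BlaserDorflerIkenmeyer2020, Thm 30 (proof), arXiv p0021.txt:L22-25] -/
theorem hwvEvalWaring_doubled_eq (D : List (List ℕ)) (k n : ℕ) :
    hwvEvalWaring (D.flatMap fun c => List.replicate (2 * k) c) n point₅ =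
      ((((placements n 5).map (weight D (2 * k))).sum : ℕ) : ℂ) := by
  rw [point₅_eq_map, hwvEvalWaring_map, hwvEvalWaring_flatMap_replicate, length_point₅ℤ,
    Nat.cast_list_sum, List.map_map, map_list_sum, List.map_map]
  congr 1
  refine List.map_congr_left fun κ _ => ?_
  simp only [Function.comp_apply, weight, map_list_prod, List.map_map, Nat.cast_list_prod]
  congr 1
  refine List.map_congr_left fun c _ => ?_
  simp only [Function.comp_apply, map_pow, eq_intCast]
  rw [← Int.cast_pow, ← cast_natAbs_pow_two_mul, Int.cast_natCast]

/-- A sum of natural numbers vanishes iff every summand does. [folklore] -/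
private theorem natList_sum_eq_zero_iff (l : List ℕ) : l.sum = 0 ↔ ∀ x ∈ l, x = 0 := by
  induction l with
  | nil => simp
  | cons a l ih => simp [ih]

/-- A summand is nonzero iff its placement is injective on every column (for `k ≥ 1`, columns
of height `≤ 5`). [cite: BlaserDorflerIkenmeyer2020, Thm 30 (proof), arXiv p0021.txt:L23-24] -/
theorem weight_ne_zero_iff (D : List (List ℕ)) {k n : ℕ} (hk : 0 < k)
    (hD : ∀ c ∈ D, c.length ≤ 5) {κ : List ℕ} (hκ : κ ∈ placements n 5) :
    weight D (2 * k) κ ≠ 0 ↔ ∀ c ∈ D, (c.map fun u => κ.getD u 0).Nodup := by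
  unfold weight
  rw [Ne, List.prod_eq_zero_iff, List.mem_map, not_exists]
  have hκ5 : ∀ c : List ℕ, ∀ u ∈ c, κ.getD u 0 < 5 := fun c u _ =>
    getD_lt_of_mem_placements hκ (by norm_num) u
  constructor
  · intro h c hc
    rw [← colDet_point₅ℤ_ne_zero_iff κ c (hD c hc) (hκ5 c)]
    intro h0
    exact h c ⟨hc, by rw [h0, Int.natAbs_zero, zero_pow (by omega)]⟩
  · rintro h c ⟨hc, h0⟩
    rw [pow_eq_zero_iff (by omega : 2 * k ≠ 0), Int.natAbs_eq_zero] at h0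
    exact (colDet_point₅ℤ_ne_zero_iff κ c (hD c hc) (hκ5 c)).2 (h c hc) h0

/-- **Nonvanishing criterion.** For `k ≥ 1` and columns of height `≤ 5`: `f_T̂(p) ≠ 0` for the
tableau `T̂` = `D` with every column repeated `2k` times iff SOME placement of the five forms is
injective on every column of `D`. [cite: BlaserDorflerIkenmeyer2020, Thm 30 (proof), arXiv p0021.txt:L22-25] -/
theorem hwvEvalWaring_doubled_ne_zero_iff (D : List (List ℕ)) {k : ℕ} (n : ℕ) (hk : 0 < k)
    (hD : ∀ c ∈ D, c.length ≤ 5) :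
    hwvEvalWaring (D.flatMap fun c => List.replicate (2 * k) c) n point₅ ≠ 0 ↔
      ∃ κ ∈ placements n 5, ∀ c ∈ D, (c.map fun u => κ.getD u 0).Nodup := by
  rw [hwvEvalWaring_doubled_eq, Ne, Nat.cast_eq_zero, natList_sum_eq_zero_iff]
  simp only [List.mem_map, forall_exists_index, and_imp, forall_apply_eq_imp_iff₂, not_forall]
  constructor
  · rintro ⟨κ, hκ, hw⟩
    exact ⟨κ, hκ, (weight_ne_zero_iff D hk hD hκ).1 hw⟩
  · rintro ⟨κ, hκ, hw⟩
    exact ⟨κ, hκ, (weight_ne_zero_iff D hk hD hκ).2 hw⟩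


/-! ### The construction `T̂ = T₁ T₂ T₃ T₄ T₅` (labels `a < b < c < d < e`) -/

section Construction

/-- `r`, the number of blocks `T_{1,i}` of `T₁` (print: `r = ⌈(|E_↕| - 1)/24⌉`; here
`r = ⌊|E_↕|/24⌋ + 1 ≥ 1`, which also satisfies the one inequality the proof uses,
`24 r + 1 ≥ |E_↕|` — "T_{3,1} has at least as many columns as T_{3,2}").
[cite: BlaserDorflerIkenmeyer2020, Thm 30 (proof), arXiv p0021.txt:L37, L97-100] -/
def rOf (S : List (List ℕ)) : ℕ := S.length / 24 + 1

variable (r : ℕ)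

/-- The three `a`-boxes `a_{3i+1}, a_{3i+2}, a_{3i+3}` (labels `3i, 3i+1, 3i+2`) on top of every
column of the block `T_{1,i+1}`. [cite: BlaserDorflerIkenmeyer2020, Thm 30 (proof), Fig. semitabconstr1 (TeX L2451-2482)] -/
def aCol (i : ℕ) : List ℕ := [3 * i, 3 * i + 1, 3 * i + 2]

/-- The boxes `b_1, b_2` (labels `3r, 3r+1`). [cite: BlaserDorflerIkenmeyer2020, Thm 30 (proof), Figs. semitabconstr1/2] -/
def bCol : List ℕ := [3 * r, 3 * r + 1]

/-- The label of `c_{j+1}` (`j < 8r`): `3r + 2 + j`. [cite: BlaserDorflerIkenmeyer2020, Thm 30 (proof: "then to all the b_i, c_i, d_i and e_i in order")] -/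
def cLab (j : ℕ) : ℕ := 3 * r + 2 + j

/-- The `p`-th blocker pair `c_{2p+1}, c_{2p+2}` (`p < 4r`) as a two-box column.
[cite: BlaserDorflerIkenmeyer2020, Thm 30 (proof), T_{3,1} (arXiv p0021.txt:L40-68)] -/
def cCol (p : ℕ) : List ℕ := [cLab r (2 * p), cLab r (2 * p + 1)]

/-- The boxes `d_1, d_2` (labels `11r+2, 11r+3`). [cite: BlaserDorflerIkenmeyer2020, Thm 30 (proof), Fig. semitabconstr2 (TeX L2484-2508)] -/
def dCol : List ℕ := [11 * r + 2, 11 * r + 3]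

/-- The label of the vertex box `e_{v+1}`: `11r + 4 + v`. [cite: BlaserDorflerIkenmeyer2020, Thm 30 (proof)] -/
def eLab (v : ℕ) : ℕ := 11 * r + 4 + v

/-- The bottom two boxes of the `t`-th column of `T₁` (`t < 8r`), read off Fig. semitabconstr1
with the printed multiplicities `2,4,4,4,2` halved (every column of `T̂` is doubled at the end):
`b_1 b_2` under the first column, then the blocker pairs `C_1, C_1, C_2, C_2, C_3, C_3, C_4 | C_4,
C_5, C_5, …`, i.e. pair `⌊(t-1)/2⌋` under column `t ≥ 1` (consecutive blocks share their last /
first pair, the last pair `C_{4r}` occurs once).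
[cite: BlaserDorflerIkenmeyer2020, Thm 30 (proof), Fig. semitabconstr1 (TeX L2451-2482)] -/
def lowerCol (t : ℕ) : List ℕ := if t = 0 then bCol r else cCol r ((t - 1) / 2)

/-- **`T₁`** (halved): `8r` columns of height `5`, column `t` = `a`-triple of block `⌊t/8⌋` over
`lowerCol t`. [cite: BlaserDorflerIkenmeyer2020, Thm 30 (proof), Fig. semitabconstr1 (TeX L2451-2482)] -/
def part1 : List (List ℕ) := (List.range (8 * r)).map fun t => aCol (t / 8) ++ lowerCol r t

/-- **`T₂`** (halved): the column `b_1 b_2 d_1 d_2` seven times (print: `14`).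
[cite: BlaserDorflerIkenmeyer2020, Thm 30 (proof), Fig. semitabconstr2 (TeX L2484-2508)] -/
def part2 : List (List ℕ) := List.replicate 7 (bCol r ++ dCol r)

/-- The `t`-th column of `T_{3,1}` (halved): the pairs `C_1, …, C_{4r-1}` six times each (print:
`12`) and `C_{4r}` seven times (print: `14`), `24r + 1` columns in all.
[cite: BlaserDorflerIkenmeyer2020, Thm 30 (proof), arXiv p0021.txt:L40-68] -/
def csCol (t : ℕ) : List ℕ := cCol r (min (t / 6) (4 * r - 1))

/-- Relabelling a column of vertex labels `v ↦ e_{v+1}`. [cite: BlaserDorflerIkenmeyer2020, Thm 30 (proof)] -/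
def shiftCol (c : List ℕ) : List ℕ := c.map (eLab r)

/-- **`T₃`** (halved): `T_{3,1}` on top of `T_{3,2} = T_↕` ("`T_3` is given as a left aligned
vertical concatenation of `T_{3,1}` and `T_{3,2}`"; columns of `T_{3,1}` beyond `|T_↕|` stand alone).
[cite: BlaserDorflerIkenmeyer2020, Thm 30 (proof), arXiv p0021.txt:L39-70] -/
def part3 (S : List (List ℕ)) : List (List ℕ) :=
  (List.range (24 * r + 1)).map fun t => csCol r t ++ shiftCol r (S.getD t [])

/-- **`T₄`** (halved): the column `d_1 d_2` once (print: twice).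
[cite: BlaserDorflerIkenmeyer2020, Thm 30 (proof), Fig. semitabconstr2 (TeX L2484-2508)] -/
def part4 : List (List ℕ) := [dCol r]

/-- **`T₅`** (halved): `T_↔` relabelled ("constructed in the exact same way as `T_{3,2}`, but is
obtained from `T_↔`"). [cite: BlaserDorflerIkenmeyer2020, Thm 30 (proof), arXiv p0021.txt:L70] -/
def part5 (S' : List (List ℕ)) : List (List ℕ) := S'.map (shiftCol r)

/-- The tableau `T̂` with HALVED multiplicities: `T₁ T₂ T₃ T₄ T₅`.
[cite: BlaserDorflerIkenmeyer2020, Thm 30 (proof), Fig. semistdhardnesstructure (TeX L2317-2348)] -/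
def halfTableau (S S' : List (List ℕ)) : List (List ℕ) :=
  part1 (rOf S) ++ part2 (rOf S) ++ part3 (rOf S) S ++ part4 (rOf S) ++ part5 (rOf S) S'

/-- **The tableau `T̂` of Thm 30 for degree `d = 16k`**: every column of `halfTableau` repeated
`2k` times in place ("each column is repeated an even number of times … In case `d > 16` we
repeat every column of `T` `d/16` times"). [cite: BlaserDorflerIkenmeyer2020, Thm 30 (proof), arXiv p0022.txt:L4-7] -/
def tableau (k : ℕ) (S S' : List (List ℕ)) : List (List ℕ) :=
  (halfTableau S S').flatMap fun c => List.replicate (2 * k) c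

/-- The number of labels of `T̂`: `3r` `a`'s, `2` `b`'s, `8r` `c`'s, `2` `d`'s and `N` vertex
labels. [cite: BlaserDorflerIkenmeyer2020, Thm 30 (proof: "T̂ has n = O(|V|) many different entries"), arXiv p0022.txt:L33] -/
def nLabels (N : ℕ) (S : List (List ℕ)) : ℕ := 11 * rOf S + 4 + N

end Construction

/-! ### Membership of the columns -/

section Mem

variable (r : ℕ) (S S' : List (List ℕ))

/-- The columns of `T₁`. [cite: BlaserDorflerIkenmeyer2020, Thm 30 (proof)] -/
theorem mem_part1 {t : ℕ} (ht : t < 8 * r) : aCol (t / 8) ++ lowerCol r t ∈ part1 r :=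
  List.mem_map.2 ⟨t, List.mem_range.2 ht, rfl⟩

/-- The columns of `T₃`. [cite: BlaserDorflerIkenmeyer2020, Thm 30 (proof)] -/
theorem mem_part3 {t : ℕ} (ht : t < 24 * r + 1) :
    csCol r t ++ shiftCol r (S.getD t []) ∈ part3 r S :=
  List.mem_map.2 ⟨t, List.mem_range.2 ht, rfl⟩

/-- The columns of `T₅`. [cite: BlaserDorflerIkenmeyer2020, Thm 30 (proof)] -/
theorem mem_part5 {c : List ℕ} (hc : c ∈ S') : shiftCol r c ∈ part5 r S' :=
  List.mem_map.2 ⟨c, hc, rfl⟩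

/-- `|T_↕| ≤ 24 r + 1`. [cite: BlaserDorflerIkenmeyer2020, Thm 30 (proof), arXiv p0021.txt:L97-100] -/
theorem length_le_rOf : S.length ≤ 24 * rOf S + 1 := by
  unfold rOf; omega

end Mem

/-! ### From a nonzero summand to a proper 3-colouring -/

section Forward

variable {r : ℕ} {S S' : List (List ℕ)} (φ : ℕ → ℕ)

/-- "is one of the two blocker forms". [cite: BlaserDorflerIkenmeyer2020, Thm 30 (proof)] -/
private def InF (f₀ f₁ y : ℕ) : Prop := y = f₀ ∨ y = f₁

/-- Pigeonhole on five forms, (a): if the two bottom boxes of a height-5 column with distinct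
forms carry the blocker forms, the three top boxes do not. [cite: BlaserDorflerIkenmeyer2020, Thm 30 (proof), arXiv p0022.txt:L11-15] -/
private theorem top_not_of_bottom {x₀ x₁ x₂ y₀ y₁ f₀ f₁ : ℕ}
    (hnd : [x₀, x₁, x₂, y₀, y₁].Nodup) (hy₀ : InF f₀ f₁ y₀) (hy₁ : InF f₀ f₁ y₁) :
    ¬ InF f₀ f₁ x₀ ∧ ¬ InF f₀ f₁ x₁ ∧ ¬ InF f₀ f₁ x₂ := by
  simp only [List.nodup_cons, List.mem_cons, List.not_mem_nil, or_false, not_or,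
    List.nodup_nil, and_true] at hnd
  unfold InF at *
  omega

/-- Pigeonhole on five forms, (b): if the three top boxes avoid the two (distinct) blocker forms,
the two bottom boxes carry them. [cite: BlaserDorflerIkenmeyer2020, Thm 30 (proof), arXiv p0022.txt:L11-15] -/
private theorem bottom_of_top {x₀ x₁ x₂ y₀ y₁ f₀ f₁ : ℕ} (h5 : ∀ z ∈ [x₀, x₁, x₂, y₀, y₁], z < 5)
    (hf₀ : f₀ < 5) (hf₁ : f₁ < 5) (hf : f₀ ≠ f₁)
    (hnd : [x₀, x₁, x₂, y₀, y₁].Nodup) (hx₀ : ¬ InF f₀ f₁ x₀) (hx₁ : ¬ InF f₀ f₁ x₁)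
    (hx₂ : ¬ InF f₀ f₁ x₂) : InF f₀ f₁ y₀ ∧ InF f₀ f₁ y₁ := by
  simp only [List.nodup_cons, List.mem_cons, List.not_mem_nil, or_false, not_or,
    List.nodup_nil, and_true, forall_eq_or_imp, forall_eq] at hnd h5
  unfold InF at *
  simp only [not_or] at hx₀ hx₁ hx₂
  -- the three top forms exhaust `{0,…,4} ∖ {f₀, f₁}`
  have hsub : ({x₀, x₁, x₂} : Finset ℕ) ⊆ Finset.range 5 \ {f₀, f₁} := by
    intro z hz
    simp only [Finset.mem_insert, Finset.mem_singleton] at hz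
    simp only [Finset.mem_sdiff, Finset.mem_range, Finset.mem_insert, Finset.mem_singleton, not_or]
    rcases hz with rfl | rfl | rfl
    · exact ⟨h5.1, hx₀⟩
    · exact ⟨h5.2.1, hx₁⟩
    · exact ⟨h5.2.2.1, hx₂⟩
  have hcard : (Finset.range 5 \ {f₀, f₁}).card ≤ ({x₀, x₁, x₂} : Finset ℕ).card := by
    rw [Finset.card_sdiff_of_subset (by
      intro z hz
      simp only [Finset.mem_insert, Finset.mem_singleton] at hz
      rcases hz with rfl | rfl <;> simpa),
      Finset.card_range, Finset.card_pair hf,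
      Finset.card_eq_three.2 ⟨x₀, x₁, x₂, hnd.1.1, hnd.1.2.1, hnd.2.1.1, rfl⟩]
  have heq := Finset.eq_of_subset_of_card_le hsub hcard
  have key : ∀ y, y < 5 → y ≠ x₀ → y ≠ x₁ → y ≠ x₂ → y = f₀ ∨ y = f₁ := by
    intro y hy h0 h1 h2
    by_contra hyf
    rw [not_or] at hyf
    have : y ∈ Finset.range 5 \ {f₀, f₁} := by
      simp only [Finset.mem_sdiff, Finset.mem_range, Finset.mem_insert, Finset.mem_singleton,
        not_or]
      exact ⟨hy, hyf⟩
    rw [← heq] at this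
    simp only [Finset.mem_insert, Finset.mem_singleton] at this
    omega
  exact ⟨key y₀ h5.2.2.2.1 (Ne.symm hnd.1.2.2.1) (Ne.symm hnd.2.1.2.1) (Ne.symm hnd.2.2.1.1),
    key y₁ h5.2.2.2.2 (Ne.symm hnd.1.2.2.2) (Ne.symm hnd.2.1.2.2) (Ne.symm hnd.2.2.1.2)⟩

/-- `lowerCol 0 = b_1 b_2`. [cite: BlaserDorflerIkenmeyer2020, Thm 30 (proof), Fig. semitabconstr1] -/
theorem lowerCol_zero : lowerCol r 0 = bCol r := by simp [lowerCol]

/-- `lowerCol (t+1)` is the blocker pair `⌊t/2⌋`. [cite: BlaserDorflerIkenmeyer2020, Thm 30 (proof), Fig. semitabconstr1] -/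
theorem lowerCol_succ (t : ℕ) : lowerCol r (t + 1) = cCol r (t / 2) := by simp [lowerCol]

variable (hφ : ∀ u, φ u < 5) (H1 : ∀ c ∈ part1 r, (c.map φ).Nodup)
include hφ H1 in

/-- **Induction along `T₁`** ("`T_{1,1}` then enforces `c_1, …, c_8` to all be assigned the last
two linear forms of `p`. Since `T_{1,i}` and `T_{1,i+1}` share the entries of `c_{8i-1}` and
`c_{8i}`, inductively … all of `c_1, …, c_{8r}` will be assigned the last two linear forms"): with
`f₀, f₁` the forms of `b_1, b_2`, for every column `t < 8r` of `T₁` the `a`-boxes avoid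
`{f₀, f₁}` and, for `t ≥ 1`, the blocker pair below carries `{f₀, f₁}`.
[cite: BlaserDorflerIkenmeyer2020, Thm 30 (proof), arXiv p0022.txt:L9-15] -/
private theorem part1_invariant (t : ℕ) (ht : t < 8 * r) :
    (∀ j ∈ aCol (t / 8), ¬ InF (φ (3 * r)) (φ (3 * r + 1)) (φ j)) ∧
      (1 ≤ t → ∀ y ∈ cCol r ((t - 1) / 2), InF (φ (3 * r)) (φ (3 * r + 1)) (φ y)) := by
  induction t with
  | zero =>
    refine ⟨?_, fun h => absurd h (by omega)⟩
    have h0 := H1 _ (mem_part1 r (t := 0) ht)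
    simp only [Nat.zero_div, lowerCol_zero, aCol, bCol, List.cons_append, List.nil_append,
      List.map_cons, List.map_nil, Nat.mul_zero, Nat.zero_add] at h0
    have := top_not_of_bottom h0 (Or.inl rfl) (Or.inr rfl)
    simp only [Nat.zero_div]
    simp only [aCol, List.mem_cons, List.not_mem_nil, or_false, forall_eq_or_imp, forall_eq]
    exact this
  | succ t ih =>
    have ih' := ih (by omega)
    have hcol := H1 _ (mem_part1 r (t := t + 1) ht)
    simp only [lowerCol_succ, aCol, cCol, List.map_cons, List.map_nil, List.cons_append,
      List.nil_append] at hcol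
    have h5 : ∀ z ∈ [φ (3 * ((t + 1) / 8)), φ (3 * ((t + 1) / 8) + 1), φ (3 * ((t + 1) / 8) + 2),
        φ (cLab r (2 * (t / 2))), φ (cLab r (2 * (t / 2) + 1))], z < 5 := fun z _ => by
      simp only [List.mem_cons, List.not_mem_nil, or_false] at *
      rcases ‹_› with rfl | rfl | rfl | rfl | rfl <;> exact hφ _
    have hf : φ (3 * r) ≠ φ (3 * r + 1) := by
      have h0 := H1 _ (mem_part1 r (t := 0) (by omega))
      simp only [Nat.zero_div, lowerCol_zero, aCol, bCol, List.cons_append, List.nil_append,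
        List.map_cons, List.map_nil, List.nodup_cons, List.mem_cons, List.not_mem_nil, or_false,
        not_or] at h0
      exact h0.2.2.2.1
    by_cases h8 : (t + 1) / 8 = t / 8
    · -- same block: the `a`-boxes are known to avoid the blocker forms
      rw [h8] at hcol h5 ⊢
      refine ⟨ih'.1, fun _ => ?_⟩
      have hb := bottom_of_top h5 (hφ _) (hφ _) hf hcol
        (ih'.1 _ (by simp [aCol])) (ih'.1 _ (by simp [aCol])) (ih'.1 _ (by simp [aCol]))
      simp only [cCol, List.mem_cons, List.not_mem_nil, or_false, forall_eq_or_imp, forall_eq]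
      exact hb
    · -- first column of the next block: its blocker pair is the last pair of the previous block
      have ht8 : (t + 1) % 8 = 0 := by omega
      have hprev : (t - 1) / 2 = t / 2 := by omega
      have hcin : ∀ y ∈ cCol r (t / 2), InF (φ (3 * r)) (φ (3 * r + 1)) (φ y) := by
        rw [← hprev]; exact ih'.2 (by omega)
      simp only [cCol, List.mem_cons, List.not_mem_nil, or_false, forall_eq_or_imp,
        forall_eq] at hcin
      have ha := top_not_of_bottom hcol hcin.1 hcin.2
      refine ⟨?_, fun _ => ?_⟩
      · simp only [aCol, List.mem_cons, List.not_mem_nil, or_false, forall_eq_or_imp, forall_eq]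
        exact ha
      · simp only [cCol, List.mem_cons, List.not_mem_nil, or_false, forall_eq_or_imp, forall_eq]
        exact hcin

include hφ H1 in
/-- **Every blocker pair carries the two blocker forms** (`p < 4r`).
[cite: BlaserDorflerIkenmeyer2020, Thm 30 (proof), arXiv p0022.txt:L13-15] -/
private theorem cCol_inF {p : ℕ} (hp : p < 4 * r) :
    ∀ y ∈ cCol r p, InF (φ (3 * r)) (φ (3 * r + 1)) (φ y) := by
  have := (part1_invariant φ hφ H1 (2 * p + 1) (by omega)).2 (by omega)
  simpa using this

/-- A vertex box sharing a column with a blocker pair avoids the blocker forms ("the linear forms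
being chosen for any `e_i` can only be the first three linear forms of `p` since the remaining two
are already used for the `c_i` of which two appear in every column").
[cite: BlaserDorflerIkenmeyer2020, Thm 30 (proof), arXiv p0022.txt:L17-19] -/
private theorem not_inF_of_nodup_append {f₀ f₁ : ℕ} {cc m : List ℕ}
    (hcc : ∀ y ∈ cc, InF f₀ f₁ (φ y)) (hcc2 : cc.length = 2)
    (hnd : ((cc ++ m).map φ).Nodup) : ∀ w ∈ m, ¬ InF f₀ f₁ (φ w) := by
  intro w hw hin
  rw [List.map_append, List.nodup_append] at hnd
  obtain ⟨hn1, -, hdis⟩ := hnd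
  match cc, hcc2 with
  | [y₀, y₁], _ =>
    simp only [List.map_cons, List.map_nil, List.nodup_cons, List.mem_cons, List.not_mem_nil,
      or_false, List.nodup_nil, and_true] at hn1
    have h0 := hcc y₀ (by simp)
    have h1 := hcc y₁ (by simp)
    unfold InF at h0 h1 hin
    have hwm : φ w ∈ m.map φ := List.mem_map.2 ⟨w, hw, rfl⟩
    have d0 := hdis (φ y₀) (by simp) (φ w) hwm
    have d1 := hdis (φ y₁) (by simp) (φ w) hwm
    omega

/-- Compressing the three non-blocker forms `{0,…,4} ∖ {f₀, f₁}` onto `{0, 1, 2}`, order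
preservingly. [folklore] -/
private def compress (f₀ f₁ x : ℕ) : ℕ :=
  x - (if f₀ < x then 1 else 0) - (if f₁ < x then 1 else 0)

/-- The compressed colour of a non-blocker form is `< 3`. [folklore] -/
private theorem compress_lt {f₀ f₁ x : ℕ} (hx : x < 5) (h₀ : f₀ < 5) (h₁ : f₁ < 5) (hf : f₀ ≠ f₁)
    (hxf : ¬ InF f₀ f₁ x) : compress f₀ f₁ x < 3 := by
  unfold compress; unfold InF at hxf; split_ifs <;> omega

/-- Compression is injective on non-blocker forms. [folklore] -/
private theorem compress_ne {f₀ f₁ x x' : ℕ} (hf : f₀ ≠ f₁) (hxf : ¬ InF f₀ f₁ x)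
    (hxf' : ¬ InF f₀ f₁ x') (hne : x ≠ x') : compress f₀ f₁ x ≠ compress f₀ f₁ x' := by
  unfold compress; unfold InF at hxf hxf'; split_ifs <;> omega

variable {N : ℕ} (hr : r = rOf S)
  (hcov : ∀ v, v < N → ∃ c ∈ S, v ∈ c) (hltS : ∀ c ∈ S, ∀ u ∈ c, u < N)
  (hltS' : ∀ c ∈ S', ∀ u ∈ c, u < N)
  (H3 : ∀ c ∈ part3 r S, (c.map φ).Nodup) (H5 : ∀ c ∈ part5 r S', (c.map φ).Nodup)
include hφ H1 hr hcov hltS hltS' H3 H5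

/-- **From a nonzero summand to a proper 3-colouring** ("there are only `3` different linear forms
being placed on all of the `e_i`, directly inducing a `3`-coloring of `G`. This `3`-coloring is
proper since every column can never contain the same linear form twice and every edge of `G` is
represented by a column"): if a placement `φ` of the five forms is injective on every column of
`T₁`, `T₃` and `T₅`, the graph `T_↕ ∪ T_↔` is properly 3-colourable.
[cite: BlaserDorflerIkenmeyer2020, Thm 30 (proof), arXiv p0022.txt:L17-19, L36-40] -/
theorem colourable_of_injective :
    ∃ col : ℕ → ℕ, (∀ v, col v < 3) ∧ ∀ c ∈ S ++ S', (c.map col).Nodup := by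
  have h1r : 1 ≤ r := by rw [hr]; unfold rOf; omega
  -- every vertex form avoids the blocker forms
  have hvert : ∀ v, v < N → ¬ InF (φ (3 * r)) (φ (3 * r + 1)) (φ (eLab r v)) := by
    intro v hv
    obtain ⟨c, hcS, hvc⟩ := hcov v hv
    obtain ⟨t, ht, rfl⟩ := List.getElem_of_mem hcS
    have ht' : t < 24 * r + 1 := by have := length_le_rOf S; omega
    have hcol := H3 _ (mem_part3 r S ht')
    rw [List.getD_eq_getElem _ _ ht] at hcol
    have hp : min (t / 6) (4 * r - 1) < 4 * r := by omega
    exact not_inF_of_nodup_append φ (cCol_inF φ hφ H1 hp) (by simp [cCol]) hcol (eLab r v)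
      (List.mem_map.2 ⟨v, hvc, rfl⟩)
  have hf : φ (3 * r) ≠ φ (3 * r + 1) := by
    have h0 := H1 _ (mem_part1 r (t := 0) (by omega))
    simp only [Nat.zero_div, lowerCol_zero, aCol, bCol, List.cons_append, List.nil_append,
      List.map_cons, List.map_nil, List.nodup_cons, List.mem_cons, List.not_mem_nil, or_false,
      not_or] at h0
    exact h0.2.2.2.1
  refine ⟨fun v => min (compress (φ (3 * r)) (φ (3 * r + 1)) (φ (eLab r v))) 2,
    fun v => Nat.lt_succ_of_le (Nat.min_le_right _ _), ?_⟩
  intro c hc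
  -- the vertex boxes of `c` carry pairwise distinct forms
  have hinj : ((shiftCol r c).map φ).Nodup := by
    rcases List.mem_append.1 hc with hcS | hcS'
    · obtain ⟨t, ht, rfl⟩ := List.getElem_of_mem hcS
      have ht' : t < 24 * r + 1 := by have := length_le_rOf S; omega
      have hcol := H3 _ (mem_part3 r S ht')
      rw [List.getD_eq_getElem _ _ ht, List.map_append] at hcol
      exact hcol.of_append_right
    · exact H5 _ (mem_part5 r S' hcS')
  have hltc : ∀ u ∈ c, u < N := by
    rcases List.mem_append.1 hc with hcS | hcS'
    · exact hltS c hcS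
    · exact hltS' c hcS'
  unfold shiftCol at hinj
  rw [List.map_map] at hinj
  have key : (c.map fun v => compress (φ (3 * r)) (φ (3 * r + 1)) (φ (eLab r v))).Nodup := by
    refine List.Nodup.map_on ?_ (hinj.of_map _)
    intro x hx y hy hxy
    by_contra hne
    have hne' : φ (eLab r x) ≠ φ (eLab r y) := by
      intro he
      exact hne (List.inj_on_of_nodup_map hinj hx hy he)
    exact compress_ne hf (hvert x (hltc x hx)) (hvert y (hltc y hy)) hne' hxy
  have heq : (c.map fun v => min (compress (φ (3 * r)) (φ (3 * r + 1)) (φ (eLab r v))) 2) =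
      c.map fun v => compress (φ (3 * r)) (φ (3 * r + 1)) (φ (eLab r v)) := by
    refine List.map_congr_left fun v hv => ?_
    have := compress_lt (hφ _) (hφ _) (hφ _) hf (hvert v (hltc v hv))
    omega
  rw [heq]
  exact key

end Forward


/-! ### From a proper 3-colouring to a nonzero summand -/

section Backward

variable (r : ℕ) (col : ℕ → ℕ)

/-- **The placement of the printed proof** read off a 3-colouring `col` of the vertices: "The
entries `a_{3i+j}` get assigned the linear form `ℓ_j` …, `b_1` and `b_2` get assigned `ℓ_4` and
`ℓ_5`, `c_{2i+j}` get assigned `ℓ_{3+j}`, `d_1` and `d_2` get assigned `ℓ_1` and `ℓ_2`, `e_i` get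
assigned `ℓ_j` if vertex `i` was colored with color `j`" (forms `0..4` here).
[cite: BlaserDorflerIkenmeyer2020, Thm 30 (proof), arXiv p0022.txt:L21-28] -/
def colForm (u : ℕ) : ℕ :=
  if u < 3 * r then u % 3
  else if u < 3 * r + 2 then u - 3 * r + 3
  else if u < 11 * r + 2 then (u - (3 * r + 2)) % 2 + 3
  else if u < 11 * r + 4 then u - (11 * r + 2)
  else col (u - (11 * r + 4))

/-- Every form index is `< 5`. [cite: BlaserDorflerIkenmeyer2020, Thm 30 (proof)] -/
theorem colForm_lt (hcol : ∀ v, col v < 3) (u : ℕ) : colForm r col u < 5 := by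
  unfold colForm; split_ifs <;> first | omega | exact (hcol _).trans (by norm_num)

/-- The `a`-boxes of block `i < r` carry the forms `0, 1, 2`. [cite: BlaserDorflerIkenmeyer2020, Thm 30 (proof)] -/
theorem map_colForm_aCol {i : ℕ} (hi : i < r) : (aCol i).map (colForm r col) = [0, 1, 2] := by
  simp only [aCol, List.map_cons, List.map_nil, colForm]
  have h0 : 3 * i < 3 * r := by omega
  have h1 : 3 * i + 1 < 3 * r := by omega
  have h2 : 3 * i + 2 < 3 * r := by omega
  simp only [if_pos h0, if_pos h1, if_pos h2]
  refine List.cons_eq_cons.2 ⟨by omega, List.cons_eq_cons.2 ⟨by omega, List.cons_eq_cons.2 ⟨by omega, rfl⟩⟩⟩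

/-- The `b`-boxes carry the forms `3, 4`. [cite: BlaserDorflerIkenmeyer2020, Thm 30 (proof)] -/
theorem map_colForm_bCol : (bCol r).map (colForm r col) = [3, 4] := by
  simp only [bCol, List.map_cons, List.map_nil, colForm]
  refine List.cons_eq_cons.2 ⟨by split_ifs <;> omega, List.cons_eq_cons.2 ⟨by split_ifs <;> omega, rfl⟩⟩

/-- Every blocker pair `p < 4r` carries the forms `3, 4`. [cite: BlaserDorflerIkenmeyer2020, Thm 30 (proof)] -/
theorem map_colForm_cCol {p : ℕ} (hp : p < 4 * r) : (cCol r p).map (colForm r col) = [3, 4] := by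
  simp only [cCol, cLab, List.map_cons, List.map_nil, colForm]
  refine List.cons_eq_cons.2 ⟨by split_ifs <;> omega, List.cons_eq_cons.2 ⟨by split_ifs <;> omega, rfl⟩⟩

/-- The `d`-boxes carry the forms `0, 1`. [cite: BlaserDorflerIkenmeyer2020, Thm 30 (proof)] -/
theorem map_colForm_dCol : (dCol r).map (colForm r col) = [0, 1] := by
  simp only [dCol, List.map_cons, List.map_nil, colForm]
  refine List.cons_eq_cons.2 ⟨by split_ifs <;> omega, List.cons_eq_cons.2 ⟨by split_ifs <;> omega, rfl⟩⟩

/-- The vertex boxes carry the colours. [cite: BlaserDorflerIkenmeyer2020, Thm 30 (proof)] -/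
theorem map_colForm_shiftCol (c : List ℕ) : (shiftCol r c).map (colForm r col) = c.map col := by
  unfold shiftCol
  rw [List.map_map]
  refine List.map_congr_left fun v _ => ?_
  simp only [Function.comp_apply, eLab, colForm]
  rw [if_neg (by omega), if_neg (by omega), if_neg (by omega), if_neg (by omega)]
  congr 1
  omega

/-- `3 4` followed by distinct colours `< 3` has no repetition. [folklore] -/
private theorem nodup_34_append {m : List ℕ} (hm : m.Nodup) (h3 : ∀ x ∈ m, x < 3) :
    ([3, 4] ++ m).Nodup := by
  rw [List.nodup_append]
  refine ⟨by decide, hm, ?_⟩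
  intro x hx y hy hxy
  simp only [List.mem_cons, List.not_mem_nil, or_false] at hx
  have := h3 y hy
  omega

/-- A default-read column of `S` is a column of `S` or empty. [folklore] -/
private theorem getD_nil_mem_or (S : List (List ℕ)) (t : ℕ) : S.getD t [] ∈ S ∨ S.getD t [] = [] := by
  rw [List.getD_eq_getElem?_getD]
  cases h : S[t]? with
  | none => exact Or.inr rfl
  | some c => exact Or.inl (by simpa using List.mem_of_getElem? h)

variable {S S' : List (List ℕ)} (hr : r = rOf S) (hcol : ∀ v, col v < 3)
  (hprop : ∀ c ∈ S ++ S', (c.map col).Nodup)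
include hr hcol hprop

/-- **From a proper 3-colouring to a nonzero summand**: the printed placement is injective on
every column of `T̂` ("It is now easy to check that in `T_1, T_2` and `T_4` no column contains any
linear form twice. To see that the same holds for `T_3` and `T_5` note that the only way any
column could contain the same linear form twice would be for two entries `e_u` and `e_v` to
appear in the same column and be assigned the same linear form").
[cite: BlaserDorflerIkenmeyer2020, Thm 30 (proof), arXiv p0022.txt:L29-35] -/
theorem injective_of_colourable :
    ∀ c ∈ halfTableau S S', (c.map (colForm r col)).Nodup := by
  have h1r : 1 ≤ r := by rw [hr]; unfold rOf; omega
  intro c hc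
  unfold halfTableau at hc
  rw [← hr] at hc
  simp only [List.mem_append] at hc
  rcases hc with (((hc | hc) | hc) | hc) | hc
  · -- T₁
    obtain ⟨t, ht, rfl⟩ := List.mem_map.1 hc
    rw [List.mem_range] at ht
    rw [List.map_append, map_colForm_aCol r col (by omega)]
    rcases t with _ | t
    · rw [lowerCol_zero, map_colForm_bCol]; decide
    · rw [lowerCol_succ, map_colForm_cCol r col (by omega)]; decide
  · -- T₂
    obtain ⟨_, rfl⟩ := List.mem_replicate.1 hc
    rw [List.map_append, map_colForm_bCol, map_colForm_dCol]; decide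
  · -- T₃
    obtain ⟨t, ht, rfl⟩ := List.mem_map.1 hc
    rw [List.map_append, csCol, map_colForm_cCol r col (by omega), map_colForm_shiftCol]
    refine nodup_34_append ?_ fun x hx => ?_
    · rcases getD_nil_mem_or S t with h | h
      · exact hprop _ (List.mem_append_left _ h)
      · rw [h]; exact List.nodup_nil
    · obtain ⟨v, _, rfl⟩ := List.mem_map.1 hx
      exact hcol v
  · -- T₄
    rw [part4, List.mem_singleton] at hc
    subst hc
    rw [map_colForm_dCol]; decide
  · -- T₅
    obtain ⟨c', hc', rfl⟩ := List.mem_map.1 hc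
    rw [map_colForm_shiftCol]
    exact hprop _ (List.mem_append_right _ hc')

end Backward


/-! ### Counting lemmas (content `n × 8` of the halved tableau) -/

section Counting

/-- List sums over `range` are `Finset` sums. [folklore] -/
private theorem sum_map_range (f : ℕ → ℕ) (n : ℕ) :
    ((List.range n).map f).sum = ∑ t ∈ Finset.range n, f t := by
  induction n with
  | zero => simp
  | succ n ih => rw [List.range_succ, List.map_append, List.sum_append, ih, Finset.sum_range_succ]; simp

/-- `#{t < a·m : ⌊t/a⌋ = p} = a` if `p < m`, else `0`. [folklore] -/
private theorem sum_indicator_div (a m p : ℕ) (ha : 0 < a) :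
    ∑ t ∈ Finset.range (a * m), (if t / a = p then (1 : ℕ) else 0) = if p < m then a else 0 := by
  induction m with
  | zero => simp
  | succ m ih =>
    rw [Nat.mul_succ, Finset.sum_range_add, ih]
    have : ∑ x ∈ Finset.range a, (if (a * m + x) / a = p then (1 : ℕ) else 0) =
        ∑ x ∈ Finset.range a, (if m = p then (1 : ℕ) else 0) := by
      refine Finset.sum_congr rfl fun x hx => ?_
      rw [Finset.mem_range] at hx
      have : (a * m + x) / a = m := by
        rw [Nat.add_div_of_dvd_right ⟨m, rfl⟩, Nat.mul_div_cancel_left _ ha, Nat.div_eq_of_lt hx,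
          Nat.add_zero]
      rw [this]
    rw [this, Finset.sum_const, Finset.card_range, smul_eq_mul]
    split_ifs <;> omega

/-- Default-reading the columns of `S` over a long enough range sums a function over `S`
(`f [] = 0`). [folklore] -/
private theorem sum_range_getD (f : List ℕ → ℕ) (hf : f [] = 0) :
    ∀ (S : List (List ℕ)) (M : ℕ), S.length ≤ M →
      ∑ t ∈ Finset.range M, f (S.getD t []) = (S.map f).sum
  | [], M, _ => by simp [hf]
  | c :: S, M, hM => by
    obtain ⟨M, rfl⟩ : ∃ M', M = M' + 1 := ⟨M - 1, by simp at hM; omega⟩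
    rw [Finset.sum_range_succ', List.map_cons, List.sum_cons]
    simp only [List.getD_cons_succ, List.getD_cons_zero]
    rw [sum_range_getD f hf S M (by simp at hM; omega), add_comm]

variable (r : ℕ)

/-- Occurrences in an `a`-triple. [cite: BlaserDorflerIkenmeyer2020, Thm 30 (proof: counting bullets), arXiv p0021.txt:L74-79] -/
private theorem count_aCol (u i : ℕ) : (aCol i).count u = if u / 3 = i then 1 else 0 := by
  simp only [aCol, List.count_cons, List.count_nil, beq_iff_eq]
  split_ifs <;> omega

/-- Occurrences in `b_1 b_2`. [cite: BlaserDorflerIkenmeyer2020, Thm 30 (proof: counting bullets)] -/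
private theorem count_bCol (u : ℕ) : (bCol r).count u = if u = 3 * r ∨ u = 3 * r + 1 then 1 else 0 := by
  simp only [bCol, List.count_cons, List.count_nil, beq_iff_eq]
  split_ifs <;> omega

/-- Occurrences in the blocker pair `p`. [cite: BlaserDorflerIkenmeyer2020, Thm 30 (proof: counting bullets)] -/
private theorem count_cCol (u p : ℕ) :
    (cCol r p).count u = if 3 * r + 2 ≤ u ∧ (u - (3 * r + 2)) / 2 = p then 1 else 0 := by
  simp only [cCol, cLab, List.count_cons, List.count_nil, beq_iff_eq]
  split_ifs <;> omega

/-- Occurrences in `d_1 d_2`. [cite: BlaserDorflerIkenmeyer2020, Thm 30 (proof: counting bullets)] -/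
private theorem count_dCol (u : ℕ) :
    (dCol r).count u = if u = 11 * r + 2 ∨ u = 11 * r + 3 then 1 else 0 := by
  simp only [dCol, List.count_cons, List.count_nil, beq_iff_eq]
  split_ifs <;> omega

/-- Occurrences in a relabelled vertex column. [cite: BlaserDorflerIkenmeyer2020, Thm 30 (proof: counting bullets)] -/
private theorem count_shiftCol (u : ℕ) (c : List ℕ) :
    (shiftCol r c).count u = if u < 11 * r + 4 then 0 else c.count (u - (11 * r + 4)) := by
  unfold shiftCol
  split_ifs with h
  · rw [List.count_eq_zero]
    intro hu
    obtain ⟨v, -, hv⟩ := List.mem_map.1 hu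
    unfold eLab at hv; omega
  · have hinj : Function.Injective (eLab r) := fun a b hab => by unfold eLab at hab; omega
    have hu : u = eLab r (u - (11 * r + 4)) := by unfold eLab; omega
    conv_lhs => rw [hu]
    exact List.count_map_of_injective c (eLab r) hinj _

/-- **`a`-labels occur `8` times in `T₁`** ("`a_1, …, a_{3r}` all appear exactly 16 times each in
`T_1`", halved). [cite: BlaserDorflerIkenmeyer2020, Thm 30 (proof), arXiv p0021.txt:L74] -/
private theorem sum_count_aCol (u : ℕ) :
    ∑ t ∈ Finset.range (8 * r), (aCol (t / 8)).count u = if u < 3 * r then 8 else 0 := by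
  simp only [count_aCol]
  have := sum_indicator_div 8 r (u / 3) (by norm_num)
  have h' : ∀ t, (if u / 3 = t / 8 then (1 : ℕ) else 0) = if t / 8 = u / 3 then 1 else 0 :=
    fun t => by split_ifs <;> omega
  simp only [h', this]
  split_ifs <;> omega

/-- **The bottom boxes of `T₁`**: `b_1, b_2` once (print: twice), the pairs `C_1..C_{4r-1}` twice
(print: `4` times), `C_{4r}` once (print: twice).
[cite: BlaserDorflerIkenmeyer2020, Thm 30 (proof), arXiv p0021.txt:L75-78] -/
private theorem sum_count_lowerCol (u : ℕ) (hr : 1 ≤ r) :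
    ∑ t ∈ Finset.range (8 * r), (lowerCol r t).count u =
      (if u = 3 * r ∨ u = 3 * r + 1 then 1 else 0) +
        ((if 3 * r + 2 ≤ u ∧ u < 11 * r then 2 else 0) + (if u = 11 * r ∨ u = 11 * r + 1 then 1 else 0)) := by
  obtain ⟨r', rfl⟩ : ∃ r', r = r' + 1 := ⟨r - 1, by omega⟩
  rw [show 8 * (r' + 1) = (2 * (4 * r' + 3) + 1) + 1 by ring, Finset.sum_range_succ',
    lowerCol_zero, count_bCol, add_comm]
  congr 1
  simp only [lowerCol_succ, count_cCol]
  rw [Finset.sum_range_succ]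
  by_cases hu : 3 * (r' + 1) + 2 ≤ u
  · have h' : ∀ x, (if 3 * (r' + 1) + 2 ≤ u ∧ (u - (3 * (r' + 1) + 2)) / 2 = x / 2 then (1 : ℕ) else 0) =
        if x / 2 = (u - (3 * (r' + 1) + 2)) / 2 then 1 else 0 := fun x => by split_ifs <;> omega
    simp only [h', sum_indicator_div 2 (4 * r' + 3) _ (by norm_num)]
    split_ifs <;> omega
  · have h' : ∀ x, (if 3 * (r' + 1) + 2 ≤ u ∧ (u - (3 * (r' + 1) + 2)) / 2 = x / 2 then (1 : ℕ) else 0) = 0 :=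
      fun x => by rw [if_neg (fun h => hu h.1)]
    simp only [h', Finset.sum_const_zero]
    split_ifs <;> omega

/-- **Content of `T₁`.** [cite: BlaserDorflerIkenmeyer2020, Thm 30 (proof), arXiv p0021.txt:L74-78] -/
theorem count_part1 (u : ℕ) (hr : 1 ≤ r) :
    ((part1 r).map (List.count u)).sum =
      (if u < 3 * r then 8 else 0) + ((if u = 3 * r ∨ u = 3 * r + 1 then 1 else 0) +
        ((if 3 * r + 2 ≤ u ∧ u < 11 * r then 2 else 0) + (if u = 11 * r ∨ u = 11 * r + 1 then 1 else 0))) := by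
  unfold part1
  rw [List.map_map, sum_map_range]
  simp only [Function.comp_apply, List.count_append, Finset.sum_add_distrib]
  rw [sum_count_aCol, sum_count_lowerCol r u hr]

/-- **Content of `T₂`** ("`b_1, b_2, d_1, d_2` all appear exactly 14 times in `T_2`", halved).
[cite: BlaserDorflerIkenmeyer2020, Thm 30 (proof), arXiv p0021.txt:L81] -/
theorem count_part2 (u : ℕ) :
    ((part2 r).map (List.count u)).sum =
      7 * ((if u = 3 * r ∨ u = 3 * r + 1 then 1 else 0) + (if u = 11 * r + 2 ∨ u = 11 * r + 3 then 1 else 0)) := by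
  unfold part2
  rw [List.map_replicate, List.sum_replicate, smul_eq_mul, List.count_append, count_bCol, count_dCol]

/-- **The blocker pairs in `T_{3,1}`**: `C_1..C_{4r-1}` six times, `C_{4r}` seven times (print:
`12`, `14`). [cite: BlaserDorflerIkenmeyer2020, Thm 30 (proof), arXiv p0021.txt:L84-86] -/
private theorem sum_count_csCol (u : ℕ) (hr : 1 ≤ r) :
    ∑ t ∈ Finset.range (24 * r + 1), (csCol r t).count u =
      (if 3 * r + 2 ≤ u ∧ u < 11 * r then 6 else 0) + (if u = 11 * r ∨ u = 11 * r + 1 then 7 else 0) := by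
  simp only [csCol, count_cCol]
  rw [show 24 * r + 1 = 6 * (4 * r - 1) + 7 by omega, Finset.sum_range_add]
  have h1 : ∀ x ∈ Finset.range (6 * (4 * r - 1)),
      (if 3 * r + 2 ≤ u ∧ (u - (3 * r + 2)) / 2 = min (x / 6) (4 * r - 1) then (1 : ℕ) else 0) =
        if 3 * r + 2 ≤ u then (if x / 6 = (u - (3 * r + 2)) / 2 then 1 else 0) else 0 := by
    intro x hx
    rw [Finset.mem_range] at hx
    have : min (x / 6) (4 * r - 1) = x / 6 := min_eq_left (by omega)
    rw [this]; split_ifs <;> omega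
  have h2 : ∀ x ∈ Finset.range 7,
      (if 3 * r + 2 ≤ u ∧ (u - (3 * r + 2)) / 2 = min ((6 * (4 * r - 1) + x) / 6) (4 * r - 1) then (1 : ℕ)
        else 0) = if u = 11 * r ∨ u = 11 * r + 1 then 1 else 0 := by
    intro x hx
    rw [Finset.mem_range] at hx
    have : min ((6 * (4 * r - 1) + x) / 6) (4 * r - 1) = 4 * r - 1 := min_eq_right (by omega)
    rw [this]; split_ifs <;> omega
  rw [Finset.sum_congr rfl h1, Finset.sum_congr rfl h2, Finset.sum_const, Finset.card_range,
    smul_eq_mul]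
  by_cases hu : 3 * r + 2 ≤ u
  · simp only [if_pos hu, sum_indicator_div 6 (4 * r - 1) _ (by norm_num : 0 < 6)]
    split_ifs <;> omega
  · simp only [if_neg hu, Finset.sum_const_zero]
    split_ifs <;> omega

/-- **Content of `T₃`**: the blocker pairs of `T_{3,1}` and the vertex boxes of `T_{3,2} = T_↕`.
[cite: BlaserDorflerIkenmeyer2020, Thm 30 (proof), arXiv p0021.txt:L84-88] -/
theorem count_part3 (S : List (List ℕ)) (u : ℕ) (hr : 1 ≤ r) (hS : S.length ≤ 24 * r + 1) :
    ((part3 r S).map (List.count u)).sum =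
      (if 3 * r + 2 ≤ u ∧ u < 11 * r then 6 else 0) + (if u = 11 * r ∨ u = 11 * r + 1 then 7 else 0) +
        (if u < 11 * r + 4 then 0 else (S.map (List.count (u - (11 * r + 4)))).sum) := by
  unfold part3
  rw [List.map_map, sum_map_range]
  simp only [Function.comp_apply, List.count_append, Finset.sum_add_distrib]
  rw [sum_count_csCol r u hr]
  congr 1
  simp only [count_shiftCol]
  split_ifs with h
  · simp
  · exact sum_range_getD (fun c => c.count (u - (11 * r + 4))) (by simp) S _ hS

/-- **Content of `T₄`.** [cite: BlaserDorflerIkenmeyer2020, Thm 30 (proof), arXiv p0021.txt:L81] -/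
theorem count_part4 (u : ℕ) :
    ((part4 r).map (List.count u)).sum = if u = 11 * r + 2 ∨ u = 11 * r + 3 then 1 else 0 := by
  simp [part4, count_dCol]

/-- **Content of `T₅`** (the vertex boxes of `T_↔`). [cite: BlaserDorflerIkenmeyer2020, Thm 30 (proof)] -/
theorem count_part5 (S' : List (List ℕ)) (u : ℕ) :
    ((part5 r S').map (List.count u)).sum =
      if u < 11 * r + 4 then 0 else (S'.map (List.count (u - (11 * r + 4)))).sum := by
  unfold part5
  rw [List.map_map]
  simp only [Function.comp_def, count_shiftCol]
  split_ifs
  · simp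
  · rfl

end Counting


/-! ### Content, heights and entries of the halved tableau -/

section HalfTableau

variable {N : ℕ} {S S' : List (List ℕ)}

/-- **Every label occurs exactly `8` times in the halved tableau** ("Combining all the properties
we see that `T̂` contains every entry exactly `16` times each"), given that every vertex has
degree `8` in `T_↕ ∪ T_↔`. [cite: BlaserDorflerIkenmeyer2020, Thm 30 (proof), arXiv p0022.txt:L2-3] -/
theorem count_halfTableau (hdeg : ∀ v, v < N → ((S ++ S').map (List.count v)).sum = 8)
    {u : ℕ} (hu : u < nLabels N S) : ((halfTableau S S').map (List.count u)).sum = 8 := by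
  have h1r : 1 ≤ rOf S := by unfold rOf; omega
  unfold halfTableau
  simp only [List.map_append, List.sum_append]
  rw [count_part1 _ u h1r, count_part2, count_part3 _ S u h1r (length_le_rOf S), count_part4,
    count_part5]
  unfold nLabels at hu
  by_cases he : u < 11 * rOf S + 4
  · simp only [if_pos he]
    split_ifs <;> omega
  · simp only [if_neg he]
    have hv := hdeg (u - (11 * rOf S + 4)) (by omega)
    rw [List.map_append, List.sum_append] at hv
    split_ifs <;> omega

/-- The columns of the halved tableau have height `≤ 5` (vertex columns have height `2`).
[cite: BlaserDorflerIkenmeyer2020, Thm 30 (proof: "the 5 row Young tableau T̂")] -/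
theorem length_le_five (hS : ∀ c ∈ S, c.length = 2) (hS' : ∀ c ∈ S', c.length = 2) :
    ∀ c ∈ halfTableau S S', c.length ≤ 5 := by
  intro c hc
  unfold halfTableau at hc
  simp only [List.mem_append] at hc
  rcases hc with (((hc | hc) | hc) | hc) | hc
  · obtain ⟨t, -, rfl⟩ := List.mem_map.1 hc
    unfold lowerCol; split_ifs <;> simp [aCol, bCol, cCol]
  · obtain ⟨-, rfl⟩ := List.mem_replicate.1 hc; simp [bCol, dCol]
  · obtain ⟨t, -, rfl⟩ := List.mem_map.1 hc
    rw [List.length_append, csCol, cCol, shiftCol, List.length_map]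
    rcases getD_nil_mem_or S t with h | h
    · rw [hS _ h]; simp
    · rw [h]; simp
  · rw [part4, List.mem_singleton] at hc; subst hc; simp [dCol]
  · obtain ⟨c', hc', rfl⟩ := List.mem_map.1 hc
    rw [shiftCol, List.length_map, hS' _ hc']; omega

/-- The columns of the halved tableau are nonempty. [cite: BlaserDorflerIkenmeyer2020, Thm 30 (proof)] -/
theorem ne_nil_of_mem (hS' : ∀ c ∈ S', c.length = 2) : ∀ c ∈ halfTableau S S', c ≠ [] := by
  intro c hc
  unfold halfTableau at hc
  simp only [List.mem_append] at hc
  rcases hc with (((hc | hc) | hc) | hc) | hc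
  · obtain ⟨t, -, rfl⟩ := List.mem_map.1 hc; simp [aCol]
  · obtain ⟨-, rfl⟩ := List.mem_replicate.1 hc; simp [bCol]
  · obtain ⟨t, -, rfl⟩ := List.mem_map.1 hc; simp [csCol, cCol]
  · rw [part4, List.mem_singleton] at hc; subst hc; simp [dCol]
  · obtain ⟨c', hc', rfl⟩ := List.mem_map.1 hc
    rw [shiftCol, ne_eq, List.map_eq_nil_iff, ← List.length_eq_zero_iff, hS' _ hc']; omega

/-- Every entry of the halved tableau is `< 11r + 4 + N`.
[cite: BlaserDorflerIkenmeyer2020, Thm 30 (proof: "T̂ has n = O(|V|) many different entries")] -/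
theorem lt_of_mem (hltS : ∀ c ∈ S, ∀ u ∈ c, u < N) (hltS' : ∀ c ∈ S', ∀ u ∈ c, u < N) :
    ∀ c ∈ halfTableau S S', ∀ u ∈ c, u < nLabels N S := by
  have h1r : 1 ≤ rOf S := by unfold rOf; omega
  intro c hc u hu
  unfold nLabels
  unfold halfTableau at hc
  simp only [List.mem_append] at hc
  rcases hc with (((hc | hc) | hc) | hc) | hc
  · obtain ⟨t, ht, rfl⟩ := List.mem_map.1 hc
    rw [List.mem_range] at ht
    rw [List.mem_append] at hu
    rcases hu with hu | hu
    · simp only [aCol, List.mem_cons, List.not_mem_nil, or_false] at hu; omega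
    · unfold lowerCol at hu
      split_ifs at hu <;>
        simp only [bCol, cCol, cLab, List.mem_cons, List.not_mem_nil, or_false] at hu <;> omega
  · obtain ⟨-, rfl⟩ := List.mem_replicate.1 hc
    simp only [bCol, dCol, List.mem_append, List.mem_cons, List.not_mem_nil, or_false] at hu; omega
  · obtain ⟨t, ht, rfl⟩ := List.mem_map.1 hc
    rw [List.mem_range] at ht
    rw [List.mem_append] at hu
    rcases hu with hu | hu
    · simp only [csCol, cCol, cLab, List.mem_cons, List.not_mem_nil, or_false] at hu; omega
    · obtain ⟨v, hv, rfl⟩ := List.mem_map.1 hu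
      rcases getD_nil_mem_or S t with h | h
      · have := hltS _ h v hv; unfold eLab; omega
      · rw [h] at hv; simp at hv
  · rw [part4, List.mem_singleton] at hc; subst hc
    simp only [dCol, List.mem_cons, List.not_mem_nil, or_false] at hu; omega
  · obtain ⟨c', hc', rfl⟩ := List.mem_map.1 hc
    obtain ⟨v, hv, rfl⟩ := List.mem_map.1 hu
    have := hltS' _ hc' v hv; unfold eLab; omega

end HalfTableau


/-! ### Semistandardness of the halved tableau -/

section Semistandard

/-- The row condition of `IsSemistandard` between consecutive columns (entrywise `≤` on the rows
the later column has). [cite: BlaserDorflerIkenmeyer2020, Def 3 (arXiv; = CCC 2021 Def 5.1)] -/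
def rowRel (c c' : List ℕ) : Prop := ∀ i, i < c'.length → c.getD i 0 ≤ c'.getD i 0

/-- `IsSemistandard` unfolded. [cite: BlaserDorflerIkenmeyer2020, Def 3 (arXiv; = CCC 2021 Def 5.1)] -/
theorem isSemistandard_iff (T : List (List ℕ)) :
    IsSemistandard T ↔ (∀ c ∈ T, c.IsChain (· < ·)) ∧ T.IsChain rowRel := Iff.rfl

/-- `rowRel` is reflexive. [folklore] -/
private theorem rowRel_refl (c : List ℕ) : rowRel c c := fun _ _ => le_rfl

variable (r : ℕ)

/-- Relabelling preserves the row condition. [folklore] -/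
private theorem rowRel_shiftCol {c c' : List ℕ} (h : rowRel c c') : rowRel (shiftCol r c) (shiftCol r c') := by
  intro i hi
  unfold shiftCol at hi ⊢
  rw [List.length_map] at hi
  rw [List.getD_eq_getElem?_getD, List.getD_eq_getElem?_getD, List.getElem?_map, List.getElem?_map,
    List.getElem?_eq_getElem hi, Option.map_some, Option.getD_some]
  by_cases hi' : i < c.length
  · rw [List.getElem?_eq_getElem hi', Option.map_some, Option.getD_some]
    have := h i hi
    rw [List.getD_eq_getElem _ _ hi', List.getD_eq_getElem _ _ hi] at this
    unfold eLab; omega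
  · rw [List.getElem?_eq_none (by omega)]; simp

/-- Relabelling preserves strict increase. [folklore] -/
private theorem isChain_shiftCol {c : List ℕ} (h : c.IsChain (· < ·)) : (shiftCol r c).IsChain (· < ·) := by
  unfold shiftCol
  rw [List.isChain_map]
  exact List.IsChain.imp (fun a b hab => by unfold eLab; omega) h

/-- Prefixing two consecutive columns with blocker pairs `C_m, C_{m'}`, `m ≤ m'`, preserves the row
condition. [cite: BlaserDorflerIkenmeyer2020, Thm 30 (proof: "T_3 is semistandard")] -/
theorem rowRel_cCol_append {m m' : ℕ} (hm : m ≤ m') {x x' : List ℕ} (h : rowRel x x') :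
    rowRel (cCol r m ++ x) (cCol r m' ++ x') := by
  intro i hi
  rw [List.length_append] at hi
  by_cases h2 : i < 2
  · rw [List.getD_append _ _ _ _ (by simp [cCol]; omega),
      List.getD_append _ _ _ _ (by simp [cCol]; omega)]
    interval_cases i <;> simp [cCol, cLab] <;> omega
  · rw [List.getD_append_right _ _ _ _ (by simp [cCol]; omega),
      List.getD_append_right _ _ _ _ (by simp [cCol]; omega)]
    simp only [cCol, List.length_cons, List.length_nil]
    exact h (i - 2) (by simp [cCol] at hi; omega)

variable {S S' : List (List ℕ)}

/-- **The columns of the halved tableau are strictly increasing** ("This ensures that each of the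
`T_i` individually, but also the concatenation `T̂` will be semistandard").
[cite: BlaserDorflerIkenmeyer2020, Thm 30 (proof), arXiv p0021.txt:L33-35] -/
theorem isChain_lt_of_mem (hr : r = rOf S) (hS : ∀ c ∈ S, c.IsChain (· < ·))
    (hS' : ∀ c ∈ S', c.IsChain (· < ·)) :
    ∀ c ∈ halfTableau S S', c.IsChain (· < ·) := by
  have h1r : 1 ≤ r := by rw [hr]; unfold rOf; omega
  intro c hc
  unfold halfTableau at hc
  rw [← hr] at hc
  simp only [List.mem_append] at hc
  rcases hc with (((hc | hc) | hc) | hc) | hc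
  · obtain ⟨t, ht, rfl⟩ := List.mem_map.1 hc
    rw [List.mem_range] at ht
    rcases t with _ | t
    · rw [lowerCol_zero]; simp [aCol, bCol, List.isChain_cons_cons]; omega
    · rw [lowerCol_succ]; simp [aCol, cCol, cLab, List.isChain_cons_cons]; omega
  · obtain ⟨-, rfl⟩ := List.mem_replicate.1 hc
    simp [bCol, dCol, List.isChain_cons_cons]; omega
  · obtain ⟨t, ht, rfl⟩ := List.mem_map.1 hc
    refine List.IsChain.append (by simp [csCol, cCol, cLab, List.isChain_cons_cons]) ?_ ?_
    · rcases getD_nil_mem_or S t with h | h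
      · exact isChain_shiftCol r (hS _ h)
      · rw [h]; simp [shiftCol]
    · intro x hx y hy
      simp only [csCol, cCol, List.getLast?_cons_cons, List.getLast?_singleton,
        Option.mem_def, Option.some.injEq] at hx
      unfold shiftCol at hy
      rw [List.head?_map, Option.mem_def, Option.map_eq_some_iff] at hy
      obtain ⟨v, -, rfl⟩ := hy
      subst hx; unfold cLab eLab; omega
  · rw [part4, List.mem_singleton] at hc; subst hc
    simp [dCol, List.isChain_cons_cons]
  · obtain ⟨c', hc', rfl⟩ := List.mem_map.1 hc
    exact isChain_shiftCol r (hS' _ hc')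

/-- The row condition along `T₁`. [cite: BlaserDorflerIkenmeyer2020, Thm 30 (proof: "T_1 is semistandard"), arXiv p0021.txt:L79] -/
theorem isChain_rowRel_part1 : (part1 r).IsChain rowRel := by
  unfold part1
  rw [List.isChain_map, List.isChain_range]
  intro t _
  show rowRel _ _
  have hmono : 3 * (t / 8) ≤ 3 * ((t + 1) / 8) := by omega
  rcases t with _ | t
  · rw [lowerCol_zero, lowerCol_succ]
    intro i hi
    simp only [List.length_append, aCol, cCol, List.length_cons, List.length_nil] at hi
    interval_cases i <;> simp [aCol, bCol, cCol, cLab]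
  · rw [lowerCol_succ, lowerCol_succ]
    intro i hi
    simp only [List.length_append, aCol, cCol, List.length_cons, List.length_nil] at hi
    have hmono' : 2 * (t / 2) ≤ 2 * ((t + 1) / 2) := by omega
    interval_cases i <;> simp [aCol, cCol, cLab] <;> omega

/-- The row condition along `T₃` (from that of `T_↕`). [cite: BlaserDorflerIkenmeyer2020, Thm 30 (proof: "T_3 is semistandard"), arXiv p0021.txt:L87] -/
theorem isChain_rowRel_part3 (hS : S.IsChain rowRel) : (part3 r S).IsChain rowRel := by
  unfold part3
  rw [List.isChain_map, List.isChain_range]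
  intro t _
  show rowRel _ _
  unfold csCol
  refine rowRel_cCol_append r (by omega) ?_
  apply rowRel_shiftCol
  intro i hi
  by_cases ht : t + 1 < S.length
  · rw [List.getD_eq_getElem _ _ ht] at hi ⊢
    rw [List.getD_eq_getElem _ _ (Nat.lt_of_succ_lt ht)]
    exact List.isChain_iff_getElem.1 hS t ht i hi
  · rw [List.getD_eq_default _ _ (by omega)] at hi
    simp at hi

/-- The row condition along `T₅` (from that of `T_↔`). [cite: BlaserDorflerIkenmeyer2020, Thm 30 (proof)] -/
theorem isChain_rowRel_part5 (hS' : S'.IsChain rowRel) : (part5 r S').IsChain rowRel := by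
  unfold part5
  rw [List.isChain_map]
  exact List.IsChain.imp (fun a b hab => rowRel_shiftCol r hab) hS'

/-- **The halved tableau satisfies the row condition** ("the concatenation `T̂` will be
semistandard. The latter can be seen by looking at the symbolic entries at the left and right
borders of the `T_i`"). [cite: BlaserDorflerIkenmeyer2020, Thm 30 (proof), arXiv p0021.txt:L33-35] -/
theorem isChain_rowRel_halfTableau (hS : S.IsChain rowRel) (hS' : S'.IsChain rowRel)
    (hlen' : ∀ c ∈ S', c.length = 2) : (halfTableau S S').IsChain rowRel := by
  have h1r : 1 ≤ rOf S := by unfold rOf; omega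
  unfold halfTableau
  set r := rOf S with hr
  rw [List.append_assoc, List.append_assoc, List.append_assoc]
  -- T₄ T₅
  have h45 : (part4 r ++ part5 r S').IsChain rowRel := by
    refine List.IsChain.append (List.isChain_singleton _) (isChain_rowRel_part5 r hS') ?_
    intro x hx y hy
    simp only [part4, List.getLast?_singleton, Option.mem_def, Option.some.injEq] at hx
    subst hx
    unfold part5 at hy
    rw [List.head?_map, Option.mem_def, Option.map_eq_some_iff] at hy
    obtain ⟨e0, he0, rfl⟩ := hy
    have hc2 := hlen' e0 (List.mem_of_mem_head? he0)
    intro i hi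
    rw [shiftCol, List.length_map, hc2] at hi
    have hsh : (shiftCol r e0).getD i 0 = eLab r (e0.get ⟨i, by omega⟩) := by
      unfold shiftCol
      simp only [List.getD_eq_getElem?_getD, List.getElem?_map, List.get_eq_getElem,
        List.getElem?_eq_getElem (by omega : i < e0.length), Option.map_some, Option.getD_some]
    rw [hsh]
    interval_cases i <;> simp [dCol, eLab] <;> omega
  -- T₃ (T₄ T₅)
  have h345 : (part3 r S ++ (part4 r ++ part5 r S')).IsChain rowRel := by
    refine List.IsChain.append (isChain_rowRel_part3 r hS) h45 ?_
    intro x hx y hy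
    simp only [List.head?_append, part4, List.head?_cons, Option.some_or, Option.mem_def,
      Option.some.injEq] at hy
    subst hy
    unfold part3 at hx
    rw [List.getLast?_map, List.getLast?_range, if_neg (by omega), Option.map_some, Option.mem_def,
      Option.some.injEq] at hx
    subst hx
    intro i hi
    simp only [dCol, List.length_cons, List.length_nil] at hi
    rw [List.getD_append _ _ _ _ (by simp [csCol, cCol]; omega)]
    interval_cases i <;> simp [csCol, cCol, cLab, dCol] <;> omega
  -- T₂ (T₃ T₄ T₅)
  have h2345 : (part2 r ++ (part3 r S ++ (part4 r ++ part5 r S'))).IsChain rowRel := by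
    refine List.IsChain.append (List.isChain_replicate_of_rel _ (rowRel_refl _)) h345 ?_
    intro x hx y hy
    unfold part2 at hx
    rw [List.getLast?_replicate, if_neg (by norm_num), Option.mem_def, Option.some.injEq] at hx
    subst hx
    unfold part3 at hy
    rw [List.head?_append, List.head?_map, List.head?_range, if_neg (by omega), Option.map_some,
      Option.some_or, Option.mem_def, Option.some.injEq] at hy
    subst hy
    unfold csCol
    rw [show bCol r ++ dCol r = [3 * r, 3 * r + 1] ++ dCol r from rfl]
    have : cCol r (min (0 / 6) (4 * r - 1)) = cCol r 0 := by rw [Nat.zero_div, Nat.min_eq_left (by omega)]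
    rw [this]
    intro i hi
    rw [List.length_append] at hi
    by_cases h2 : i < 2
    · rw [List.getD_append _ _ _ _ (by simp; omega), List.getD_append _ _ _ _ (by simp [cCol]; omega)]
      interval_cases i <;> simp [cCol, cLab]
    · rw [List.getD_append_right _ _ _ _ (by simp; omega),
        List.getD_append_right _ _ _ _ (by simp [cCol]; omega)]
      simp only [List.length_cons, List.length_nil, cCol] at hi ⊢
      set e0 := S.getD 0 [] with he0
      have hlt : i - 2 < e0.length := by simp [shiftCol] at hi; omega
      have hsh : (shiftCol r e0).getD (i - 2) 0 = eLab r (e0.get ⟨i - 2, hlt⟩) := by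
        unfold shiftCol
        simp only [List.getD_eq_getElem?_getD, List.getElem?_map, List.get_eq_getElem,
          List.getElem?_eq_getElem hlt, Option.map_some, Option.getD_some]
      rw [hsh]
      by_cases hi4 : i - 2 < 2
      · interval_cases hi2 : i - 2 <;> simp [dCol, eLab] <;> omega
      · rw [List.getD_eq_default _ _ (by simp [dCol]; omega)]; exact Nat.zero_le _
  -- T₁ (T₂ T₃ T₄ T₅)
  refine List.IsChain.append (isChain_rowRel_part1 r) h2345 ?_
  intro x hx y hy
  unfold part2 at hy
  rw [List.head?_append, List.head?_replicate, if_neg (by norm_num), Option.some_or, Option.mem_def,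
    Option.some.injEq] at hy
  subst hy
  unfold part1 at hx
  rw [List.getLast?_map, List.getLast?_range, if_neg (by omega), Option.map_some, Option.mem_def,
    Option.some.injEq] at hx
  subst hx
  obtain ⟨r', hr'⟩ : ∃ r', r = r' + 1 := ⟨r - 1, by omega⟩
  rw [show 8 * r - 1 = 8 * r' + 7 by omega, lowerCol_succ]
  intro i hi
  simp only [List.length_append, bCol, dCol, List.length_cons, List.length_nil] at hi
  interval_cases i <;> simp [aCol, bCol, cCol, cLab, dCol] <;> omega

/-- **The halved tableau is semistandard.** [cite: BlaserDorflerIkenmeyer2020, Thm 30 (proof), arXiv p0021.txt:L33-35, p0022.txt:L2-3] -/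
theorem isSemistandard_halfTableau (hS : IsSemistandard S) (hS' : IsSemistandard S')
    (hlen' : ∀ c ∈ S', c.length = 2) : IsSemistandard (halfTableau S S') :=
  ⟨isChain_lt_of_mem (rOf S) rfl hS.1 hS'.1, isChain_rowRel_halfTableau hS.2 hS'.2 hlen'⟩

end Semistandard


/-! ### Shape: weakly decreasing column heights -/

section Shape

variable {S S' : List (List ℕ)}

/-- The heights of the halved tableau: `5^{8r} 4^7 4^{|T_↕|} 2^{24r+1-|T_↕|} 2 2^{|T_↔|}`.
[cite: BlaserDorflerIkenmeyer2020, Thm 30 (proof), Fig. semistdhardnesstructure (TeX L2317-2348)] -/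
theorem map_length_halfTableau (hS : ∀ c ∈ S, c.length = 2) (hS' : ∀ c ∈ S', c.length = 2) :
    (halfTableau S S').map List.length =
      List.replicate (8 * rOf S) 5 ++ (List.replicate 7 4 ++
        (((List.range (24 * rOf S + 1)).map fun t => if t < S.length then 4 else 2) ++ ([2] ++
          List.replicate S'.length 2))) := by
  have h1 : (part1 (rOf S)).map List.length = List.replicate (8 * rOf S) 5 := by
    unfold part1
    rw [List.map_map, List.eq_replicate_iff]
    refine ⟨by simp, fun b hb => ?_⟩
    obtain ⟨t, -, rfl⟩ := List.mem_map.1 hb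
    simp only [Function.comp_apply, List.length_append, aCol, lowerCol]
    split_ifs <;> simp [bCol, cCol]
  have h2 : (part2 (rOf S)).map List.length = List.replicate 7 4 := by simp [part2, bCol, dCol]
  have h3 : (part3 (rOf S) S).map List.length =
      (List.range (24 * rOf S + 1)).map fun t => if t < S.length then 4 else 2 := by
    unfold part3
    rw [List.map_map]
    refine List.map_congr_left fun t _ => ?_
    simp only [Function.comp_apply, List.length_append, csCol, cCol, shiftCol, List.length_map,
      List.length_cons, List.length_nil]
    split_ifs with h
    · rw [List.getD_eq_getElem _ _ h, hS _ (List.getElem_mem h)]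
    · rw [List.getD_eq_default _ _ (by omega)]; rfl
  have h4 : (part4 (rOf S)).map List.length = [2] := by simp [part4, dCol]
  have h5 : (part5 (rOf S) S').map List.length = List.replicate S'.length 2 := by
    unfold part5
    rw [List.map_map, List.eq_replicate_iff]
    refine ⟨by simp, fun b hb => ?_⟩
    obtain ⟨c, hc, rfl⟩ := List.mem_map.1 hb
    simp only [Function.comp_apply, shiftCol, List.length_map, hS' c hc]
  unfold halfTableau
  simp only [List.map_append, List.append_assoc, h1, h2, h3, h4, h5]

/-- **The halved tableau has partition shape** ("The last property of `T_3` is important in order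
for `T_3` and thus `T̂` to be a of proper shape for a Young tableau, i.e. have non-decreasing row
lengths"). [cite: BlaserDorflerIkenmeyer2020, Thm 30 (proof), arXiv p0022.txt:L0-1] -/
theorem pairwise_length_halfTableau (hS : ∀ c ∈ S, c.length = 2) (hS' : ∀ c ∈ S', c.length = 2) :
    (halfTableau S S').Pairwise (fun c c' => c'.length ≤ c.length) := by
  rw [← List.pairwise_map (R := fun a b : ℕ => b ≤ a) (f := List.length), map_length_halfTableau hS hS']
  set L3 := (List.range (24 * rOf S + 1)).map fun t => if t < S.length then 4 else 2 with hL3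
  have h3 : L3.Pairwise (fun a b : ℕ => b ≤ a) := by
    rw [hL3, List.pairwise_map]
    exact List.pairwise_lt_range.imp fun {a b} hab => by
      show (if b < S.length then 4 else 2) ≤ (if a < S.length then 4 else 2)
      split_ifs <;> omega
  have hmem3 : ∀ x ∈ L3, x ≤ 4 ∧ 2 ≤ x := by
    intro x hx
    rw [hL3] at hx
    obtain ⟨t, -, rfl⟩ := List.mem_map.1 hx
    split_ifs <;> omega
  -- the tail `[2] ++ 2^{|S'|}`
  have h45 : ([2] ++ List.replicate S'.length 2).Pairwise (fun a b : ℕ => b ≤ a) := by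
    rw [List.singleton_append, ← List.replicate_succ, List.pairwise_replicate]
    exact Or.inr le_rfl
  have hmem45 : ∀ x ∈ [2] ++ List.replicate S'.length 2, x = 2 := by
    intro x hx
    rw [List.singleton_append, ← List.replicate_succ, List.mem_replicate] at hx
    exact hx.2
  have h345 : (L3 ++ ([2] ++ List.replicate S'.length 2)).Pairwise (fun a b : ℕ => b ≤ a) :=
    List.pairwise_append.2 ⟨h3, h45, fun a ha b hb => by rw [hmem45 b hb]; exact (hmem3 a ha).2⟩
  have hmem345 : ∀ x ∈ L3 ++ ([2] ++ List.replicate S'.length 2), x ≤ 4 := by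
    intro x hx
    rcases List.mem_append.1 hx with hx | hx
    · exact (hmem3 x hx).1
    · rw [hmem45 x hx]; norm_num
  have h2345 : (List.replicate 7 4 ++ (L3 ++ ([2] ++ List.replicate S'.length 2))).Pairwise
      (fun a b : ℕ => b ≤ a) :=
    List.pairwise_append.2 ⟨List.pairwise_replicate.2 (Or.inr le_rfl), h345, fun a ha b hb => by
      rw [(List.mem_replicate.1 ha).2]; exact hmem345 b hb⟩
  refine List.pairwise_append.2 ⟨List.pairwise_replicate.2 (Or.inr le_rfl), h2345, fun a ha b hb => ?_⟩
  rw [(List.mem_replicate.1 ha).2]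
  rcases List.mem_append.1 hb with hb | hb
  · rw [(List.mem_replicate.1 hb).2]; norm_num
  · exact (hmem345 b hb).trans (by norm_num)

end Shape

/-! ### Doubling the columns -/

section Replicate

variable {α : Type*}

/-- Membership in a column-repeated list. [folklore] -/
private theorem mem_flatMap_replicate {l : List α} {m : ℕ} (hm : m ≠ 0) {x : α} :
    x ∈ l.flatMap (fun c => List.replicate m c) ↔ x ∈ l := by
  simp [List.mem_flatMap, List.mem_replicate, hm]

/-- `Pairwise` survives repeating the entries of a list, for a reflexive relation. [folklore] -/
private theorem pairwise_flatMap_replicate {R : α → α → Prop} {l : List α} (m : ℕ) (hl : l.Pairwise R)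
    (hrefl : ∀ x ∈ l, R x x) : (l.flatMap fun c => List.replicate m c).Pairwise R := by
  induction l with
  | nil => simp
  | cons a l ih =>
    rw [List.flatMap_cons, List.pairwise_append]
    rw [List.pairwise_cons] at hl
    refine ⟨List.pairwise_replicate.2 (Or.inr (hrefl a (by simp))), ih hl.2 fun x hx => hrefl x (by simp [hx]),
      ?_⟩
    intro x hx y hy
    obtain ⟨-, rfl⟩ := List.mem_replicate.1 hx
    obtain ⟨b, hb, hyb⟩ := List.mem_flatMap.1 hy
    rw [(List.mem_replicate.1 hyb).2]
    exact hl.1 b hb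

/-- `IsChain` survives repeating the entries of a list, for a reflexive relation. [folklore] -/
private theorem isChain_flatMap_replicate {R : α → α → Prop} {l : List α} (m : ℕ) (hl : l.IsChain R)
    (hrefl : ∀ x ∈ l, R x x) : (l.flatMap fun c => List.replicate m c).IsChain R := by
  rcases Nat.eq_zero_or_pos m with rfl | hm
  · have : (l.flatMap fun c => List.replicate 0 c) = [] := by induction l <;> simp [*]
    rw [this]; exact List.isChain_nil
  induction l with
  | nil => simp
  | cons a l ih =>
    rw [List.flatMap_cons]
    refine List.IsChain.append (List.isChain_replicate_of_rel _ (hrefl a (by simp)))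
      (ih hl.tail fun x hx => hrefl x (by simp [hx])) ?_
    intro x hx y hy
    rw [List.getLast?_replicate, if_neg (by omega), Option.mem_def, Option.some.injEq] at hx
    subst hx
    cases l with
    | nil => simp at hy
    | cons b l =>
      rw [List.flatMap_cons, List.head?_append, List.head?_replicate, if_neg (by omega),
        Option.some_or, Option.mem_def, Option.some.injEq] at hy
      subst hy
      exact (List.isChain_cons_cons.1 hl).1

/-- Counting in a column-repeated list. [folklore] -/
private theorem sum_map_count_flatMap_replicate (l : List (List ℕ)) (m u : ℕ) :
    ((l.flatMap fun c => List.replicate m c).map (List.count u)).sum = m * (l.map (List.count u)).sum := by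
  induction l with
  | nil => simp
  | cons a l ih =>
    rw [List.flatMap_cons, List.map_append, List.sum_append, ih, List.map_cons, List.sum_cons,
      List.map_replicate, List.sum_replicate, smul_eq_mul, Nat.mul_add]

end Replicate

/-! ### The number of labels is determined by the content -/

/-- A tableau of content `n × d`, `d > 0`, all of whose entries are `< n'`, has `n ≤ n'`.
[cite: BlaserDorflerIkenmeyer2020, Def 3 (arXiv; = CCC 2021 Def 5.1)] -/
theorem le_of_content {T : List (List ℕ)} {n n' d : ℕ} (hd : 0 < d)
    (hcount : ∀ u, u < n → (T.map (List.count u)).sum = d) (hlt : ∀ c ∈ T, ∀ u ∈ c, u < n') :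
    n ≤ n' := by
  by_contra h
  have hc := hcount n' (by omega)
  have : (T.map (List.count n')).sum = 0 := by
    apply List.sum_eq_zero
    intro x hx
    obtain ⟨c, hc, rfl⟩ := List.mem_map.1 hx
    exact List.count_eq_zero.2 fun hm => lt_irrefl _ (hlt c hc n' hm)
  omega

/-- The `n` of an `n × d` content (`d > 0`) is unique. [cite: BlaserDorflerIkenmeyer2020, Def 3 (arXiv; = CCC 2021 Def 5.1)] -/
theorem eq_of_isTableauOfContent {T : List (List ℕ)} {n n' d : ℕ} (hd : 0 < d)
    (h : IsTableauOfContent T n d) (h' : IsTableauOfContent T n' d) : n = n' :=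
  le_antisymm (le_of_content hd h.2.2.2 h'.2.2.1) (le_of_content hd h'.2.2.2 h.2.2.1)

/-! ### The two-row instance and the main theorems -/

/-- **The input of Thm 30's construction**, as delivered by Lemma 25 (arXiv; = CCC 2021 Lemma 8.4)
for an `8`-regular grid-like layered multigraph on the vertices `0, …, N-1` numbered layer by layer,
left to right: the inter-layer edges as the ORDERED column list `S = T_↕` and the intra-layer edges
as `S' = T_↔` — two-box columns `u v` (`u < v < N`), each list a semistandard two-row tableau,
every vertex in some column of `T_↕` ("every vertex of a grid-like layered graph is incident to an
edge going to another layer"), and every vertex in exactly `8` columns counted with multiplicity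
("`8`-regular"). Nothing else about the graph is used by the proof of Thm 30.
[cite: BlaserDorflerIkenmeyer2020, Lemma 25 and Thm 30 (proof) (arXiv; = CCC 2021 Lemma 8.4, Thm 8.9), arXiv p0018.txt:L38-44, p0021.txt:L13-16, p0022.txt:L17] -/
structure IsTwoRowInstance (N : ℕ) (S S' : List (List ℕ)) : Prop where
  /-- inter-layer columns have two boxes -/
  length_inter : ∀ c ∈ S, c.length = 2
  /-- intra-layer columns have two boxes -/
  length_intra : ∀ c ∈ S', c.length = 2
  /-- `T_↕` is semistandard -/
  semistandard_inter : IsSemistandard S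
  /-- `T_↔` is semistandard -/
  semistandard_intra : IsSemistandard S'
  /-- vertex labels are `< N` -/
  lt_inter : ∀ c ∈ S, ∀ u ∈ c, u < N
  /-- vertex labels are `< N` -/
  lt_intra : ∀ c ∈ S', ∀ u ∈ c, u < N
  /-- every vertex has an inter-layer edge -/
  cover : ∀ v, v < N → ∃ c ∈ S, v ∈ c
  /-- `8`-regularity -/
  degree : ∀ v, v < N → ((S ++ S').map (List.count v)).sum = 8

/-- **Proper 3-colourability** of the multigraph with edge (column) list `E` on vertex labels `ℕ`:
a colouring with three colours that is injective on every column.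
[cite: BlaserDorflerIkenmeyer2020, Thm 30 (arXiv; = CCC 2021 Thm 8.9: "iff no column contains the same linear form twice")] -/
def Colourable3 (E : List (List ℕ)) : Prop :=
  ∃ col : ℕ → ℕ, (∀ v, col v < 3) ∧ ∀ c ∈ E, (c.map col).Nodup

section Main

variable {N : ℕ} {S S' : List (List ℕ)} (h : IsTwoRowInstance N S S')
include h

/-- **`T̂` has content `(11r + 4 + N) × 16k`** ("`T̂` contains every entry exactly 16 times each …
In case `d > 16` we repeat every column of `T` `d/16` times").
[cite: BlaserDorflerIkenmeyer2020, Thm 30 (proof), arXiv p0022.txt:L2-7] -/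
theorem isTableauOfContent_tableau (k : ℕ) :
    IsTableauOfContent (tableau k S S') (nLabels N S) (16 * k) := by
  refine ⟨fun c hc => ?_, ?_, fun c hc => ?_, fun u hu => ?_⟩
  · rcases Nat.eq_zero_or_pos k with rfl | hk
    · simp [tableau] at hc
    · exact ne_nil_of_mem h.length_intra c ((mem_flatMap_replicate (by omega)).1 hc)
  · exact pairwise_flatMap_replicate _ (pairwise_length_halfTableau h.length_inter h.length_intra)
      fun _ _ => le_rfl
  · rcases Nat.eq_zero_or_pos k with rfl | hk
    · simp [tableau] at hc
    · exact lt_of_mem h.lt_inter h.lt_intra c ((mem_flatMap_replicate (by omega)).1 hc)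
  · unfold tableau
    rw [sum_map_count_flatMap_replicate, count_halfTableau h.degree hu]; ring

/-- **`T̂` is semistandard.** [cite: BlaserDorflerIkenmeyer2020, Thm 30 (proof), arXiv p0022.txt:L2-3] -/
theorem isSemistandard_tableau (k : ℕ) : IsSemistandard (tableau k S S') := by
  have hh := isSemistandard_halfTableau h.semistandard_inter h.semistandard_intra h.length_intra
  refine ⟨fun c hc => ?_, ?_⟩
  · rcases Nat.eq_zero_or_pos k with rfl | hk
    · simp [tableau] at hc
    · exact hh.1 c ((mem_flatMap_replicate (by omega)).1 hc)
  · exact isChain_flatMap_replicate _ hh.2 fun c _ => rowRel_refl c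

/-- `T̂` has `5` rows (columns of height `≤ 5`). [cite: BlaserDorflerIkenmeyer2020, Thm 30 (proof: "the 5 row Young tableau T̂")] -/
theorem length_le_of_mem_tableau (k : ℕ) : ∀ c ∈ tableau k S S', c.length ≤ 5 := by
  intro c hc
  rcases Nat.eq_zero_or_pos k with rfl | hk
  · simp [tableau] at hc
  · exact length_le_five h.length_inter h.length_intra c ((mem_flatMap_replicate (by omega)).1 hc)

/-- Every entry of `T̂` is `< 11r + 4 + N` (so `numLabels T̂ ≤ 11r + 4 + N = O(|T_↕| + N)`).
[cite: BlaserDorflerIkenmeyer2020, Thm 30 (proof: "T̂ has n = O(|V|) many different entries"), arXiv p0022.txt:L33] -/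
theorem lt_of_mem_tableau (k : ℕ) : ∀ c ∈ tableau k S S', ∀ u ∈ c, u < nLabels N S :=
  (isTableauOfContent_tableau h k).2.2.1

omit h in
/-- The number of labels is linear in the instance: `11 r + 4 + N ≤ |T_↕| + N + 15` with
`r = ⌊|T_↕|/24⌋ + 1`. [cite: BlaserDorflerIkenmeyer2020, Thm 30 (proof), arXiv p0022.txt:L33] -/
theorem nLabels_le : nLabels N S ≤ S.length + N + 15 := by
  unfold nLabels rOf; omega

/-- **`f_T̂(p) ≠ 0` iff the graph is properly 3-colourable** (`k ≥ 1`), at the fixed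
Waring-rank-`5` point `p = Σ ℓ_i^{16k}`, `ℓ_i = (1, i, i², i³, i⁴)`.
[cite: BlaserDorflerIkenmeyer2020, Thm 30 (proof), arXiv p0021.txt:L19-25, p0022.txt:L9-40] -/
theorem hwvEvalWaring_tableau_ne_zero_iff {k : ℕ} (hk : 0 < k) :
    hwvEvalWaring (tableau k S S') (nLabels N S) point₅ ≠ 0 ↔ Colourable3 (S ++ S') := by
  unfold tableau
  rw [hwvEvalWaring_doubled_ne_zero_iff _ _ hk (length_le_five h.length_inter h.length_intra)]
  constructor
  · rintro ⟨κ, hκ, hall⟩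
    have hφ : ∀ u, κ.getD u 0 < 5 := getD_lt_of_mem_placements hκ (by norm_num)
    unfold halfTableau at hall
    exact colourable_of_injective (fun u => κ.getD u 0) hφ
      (fun c hc => hall c (by simp [hc])) rfl h.cover h.lt_inter h.lt_intra
      (fun c hc => hall c (by simp [hc])) (fun c hc => hall c (by simp [hc]))
  · rintro ⟨col, hcol, hprop⟩
    refine ⟨(List.range (nLabels N S)).map (colForm (rOf S) col),
      map_range_mem_placements _ fun u _ => colForm_lt _ col hcol u, fun c hc => ?_⟩
    have heq : (c.map fun u => ((List.range (nLabels N S)).map (colForm (rOf S) col)).getD u 0) =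
        c.map (colForm (rOf S) col) :=
      List.map_congr_left fun u hu => getD_map_range _ (lt_of_mem h.lt_inter h.lt_intra c hc u hu)
    rw [heq]
    exact injective_of_colourable (rOf S) col rfl hcol hprop c hc

/-- **Thm 30's reduction, as a membership statement**: for `k ≥ 1` and `m ≥ 5`, the tableau `T̂`
of an `8`-regular two-row instance is a YES-instance of the evaluation problem of Thm 8.9 for
`(d, m) = (16k, m)` — semistandard, content `n × 16k`, `5 ≤ m` rows, `f_T̂(p) ≠ 0` — iff the
graph `T_↕ ∪ T_↔` is properly 3-colourable.
[cite: BlaserDorflerIkenmeyer2020, Thm 30 (arXiv; = CCC 2021 Thm 8.9), proof] -/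
theorem tableau_mem_nonvanishingSetSemistd_iff {k m : ℕ} (hk : 0 < k) (hm : 5 ≤ m) :
    tableau k S S' ∈ nonvanishingSetSemistd (16 * k) m ↔ Colourable3 (S ++ S') := by
  unfold nonvanishingSetSemistd
  rw [Set.mem_setOf_eq]
  constructor
  · rintro ⟨n, hcont, -, -, hval⟩
    rw [eq_of_isTableauOfContent (by omega) hcont (isTableauOfContent_tableau h k)] at hval
    exact (hwvEvalWaring_tableau_ne_zero_iff h hk).1 hval
  · intro hcol
    exact ⟨nLabels N S, isTableauOfContent_tableau h k, isSemistandard_tableau h k,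
      fun c hc => (length_le_of_mem_tableau h k c hc).trans hm,
      (hwvEvalWaring_tableau_ne_zero_iff h hk).2 hcol⟩

end Main

end Thm30

end BDI2020

end Literature.Computability.AlgebraicComplexity
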